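import Mathlib.NumberTheory.Chebyshev
import Mathlib.Analysis.Complex.ExponentialBounds
import Literature.NumberTheory.LFunctions.ChebyshevSylvesterPsi
import Literature.NumberTheory.LFunctions.ChebyshevCostaPereira
import Literature.NumberTheory.LFunctions.ChebyshevCostaPereira68KernelA
import Literature.NumberTheory.LFunctions.ChebyshevCostaPereira68KernelB
import HarnessLib

/-!
# A Costa Pereira-type `m = 68` Chebyshev scheme (part 4/4, main): `0.98133 x ≤ ψ(x) ≤ 1.019014 x` (`x ≥ e^{36.35}`), …, `0.984437 x ≤ ψ(x) ≤ 1.015911 x` (`x ≥ e^{98.21}`)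

Topic `Literature/NumberTheory/LFunctions` (prime distribution, elementary); namespace
`Literature.NumberTheory.LFunctions.CostaPereira68`.  Everything here is PROVED (no named facts, no
instances, no notation); `ψ`, `π` are Mathlib's `Chebyshev.psi`, `Nat.primeCounting`.

Source of the METHOD: N. Costa Pereira, *Elementary estimates for the Chebyshev function `ψ(x)` and for
the Möbius function `M(x)`*, Acta Arith. 52 (1989) 307–337 [CostaPereira1989], §§1–2: for a finitely
supported integer-valued `ν` with `ν = μ` on `[1, m)` ((1.7)) and `∑ ν(r)/r = 0` ((1.14)), the sum
`σ(x) = ∑_r ν(r) log ⌊x/r⌋!` ((2.1); here `V`) equals `∑_{k ≤ x} Λ(k) F(⌊x/k⌋)` with the bounded step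
function `F(y) = ∑_r ν(r) ⌊y/r⌋ = −∑_r ν(r) {y/r}` ((1.10), (1.15)), `σ(x) = ω x + O(log x)` with
`ω = −∑ ν(r) log r / r` ((2.2), Lemma 3 (2.5)–(2.7)), and comparing `F` from above and below with
indicator combinations of blocks `[u, v)` and tails `[t, ∞)` gives the two inequalities (2.13)–(2.14),
which Theorem 2 ((2.28)–(2.34)) turns into finite bounds `L⁻ < ψ(x)/x < L⁺` for `x ≥ N` from bounds on
a base range.  Costa Pereira's own schemes are `m = 17` (p. 321; the tree's `ChebyshevCostaPereira.lean`:
`0.9636 x ≤ ψ(x)` for `x ≥ 227`, `ψ(x) ≤ 1.0364 x` for `x ≥ 201`) and `m = 8021` ((2.43), p. 324: one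
integer `j` and one NON-INTEGER `r`, `L⁻ = 0.998118` from a base table to `10⁸`).

THE SCHEME OF THIS FILE (origin: cell `parity-ideate`, planner seat p5 g21, ROUND-44 «CP-m», pub file
`round44/port/ChebyshevCostaPereira68.lean` sha16 `f5408f2db8f11fdc`, landed here in four parts — `…68Scheme` (scheme, weights,
checker, chunks 0–2), `…68KernelA` (chunks 3–6) / `…68KernelB` (chunks 7–9) and this file (pointwise
comparisons `F_le_wL`/`wU_le_F` assembled from the ten chunks, then §4–§8) — statements and proofs verbatim,
helpers made private): `m = 68` — `ν = μ` on `[1, 68)` (44 terms), `ν(78) = −1`,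
`ν(86) = +1`, `ν(10127) = −1` and five far divisors of `67#` (`2627690: +1`, `536481544742: −1`,
`83849539269265770: +1`, `1661378763441916925133: +1`, `1571664310216053411175818: +1`) making
`∑ ν(k)/k = 0` EXACTLY with INTEGER supports (`POS`, `NEG`; 25 terms of each sign), so that `F` is a
genuine periodic step function and `−23 ≤ F ≤ 23` trivially (`F_range`); `ω = 1.00078025…` (`ω_bounds`).
The comparison weights are frozen at the design height `Z = 30000` (blocks `BLo/GLo/TLo`, `BUp/GUp/TUp`
from the level sets of `F` on `[1, 30000)`, p5 `gen44data.py` at the block fixed point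
`0.984511 / 1.015837`), `F ≤ w_L` and `w_U ≤ F` are certified pointwise below `30000` by `decide +kernel`
(ten chunks of `3000`) and hold trivially above; `|V(⌊x⌋) − ω x| ≤ 50 (log x + 2)` is the explicit form
of Lemma 3 used here; and instead of Theorem 2's induction the affine comparison step (`step_lower` /
`step_upper`, block and tail reciprocal sums certified as exact integer inequalities at scale `10¹²`) is
applied NON-INDUCTIVELY ten times («shots») starting from the tree's `m = 17` constants `0.9636 / 1.0364`:
`shot s : x ≥ 227·30000^s → l_s x ≤ ψ(x) ≤ u_s x` with
`(l, u) = (0.973319, 1.027018), (0.978545, 1.021797), (0.98133, 1.019014), (0.982815, 1.017531),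
(0.983607, 1.016741), (0.984028, 1.016319), (0.984253, 1.016095), (0.984373, 1.015975), (0.984437, 1.015911),
(0.984471, 1.015877)` (`shot1` … `shot10`; fixed point of the step `≈ 0.98451 / 1.01584`), and the
consequences `primeCounting_ge_3/4/9 : π(n) ≥ 0.98133 n/log n (n ≥ 227·30000³)`, `0.982815` (`s = 4`),
`0.984437` (`s = 9`).  These constants lie between Costa Pereira's printed `m = 17` (`25/26`) and `m = 8021`
(`530/531`) schemes; no table beyond the tree's is used (the base is the PROVED `m = 17` bound).  They feed
the explicit Shnirel'man–Goldbach chain (`ShnirelmanGoldbach*.lean`: one-shift reach, shift slopes and the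
first moment of the Goldbach count at `K = 39`).

## What is NOT here
No asymptotics, no `θ`, nothing about `x < 227·30000`; the design data (`BLo`, …) are this file's, not
Costa Pereira's tables; kernel time ≈ 13 min (the ten `chkAll_i` chunks and the sixteen prime-logarithm
enclosures dominate; `maxHeartbeats 4000000` on the two `sumLog_*_bounds`).

## References
* N. Costa Pereira, *Elementary estimates for the Chebyshev function ψ(x) and for the Möbius function
  M(x)*, Acta Arith. 52 (1989), 307–337, doi:10.4064/aa-52-4-307-337 — §1 (1.7)–(1.20), §2 (2.1)–(2.7),
  (2.13)–(2.14), Theorem 2 (2.28)–(2.34), the schemes of p. 321 and (2.43). [CostaPereira1989]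
-/

open Finset Real
open scoped Chebyshev

namespace Literature.NumberTheory.LFunctions.CostaPereira68

/-- Helper `sumDiv_zero` of the `m = 68` certificate (statement = its type; role: see the module docstring). [folklore] -/
private theorem sumDiv_zero (l : List ℕ) : sumDiv l 0 = 0 := by
  induction l with
  | nil => rfl
  | cons k l ih => simp [sumDiv, ih, Nat.zero_div]

/-- Helper `cntB_zero` of the `m = 68` certificate (statement = its type; role: see the module docstring). [folklore] -/
private theorem cntB_zero (l : List (ℕ × ℕ)) (h : ∀ b ∈ l, 1 ≤ b.1) : cntB l 0 = 0 := by
  induction l with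
  | nil => rfl
  | cons b l ih =>
    have hb := h b (by simp)
    simp only [cntB, ih (fun b' hb' => h b' (by simp [hb']))]
    unfold blk; rw [if_neg (by omega)]; simp

/-- Helper `cntT_zero` of the `m = 68` certificate (statement = its type; role: see the module docstring). [folklore] -/
private theorem cntT_zero (l : List ℕ) (h : ∀ t ∈ l, 1 ≤ t) : cntT l 0 = 0 := by
  induction l with
  | nil => rfl
  | cons t l ih =>
    have ht := h t (by simp)
    simp only [cntT, ih (fun t' ht' => h t' (by simp [ht']))]
    unfold tail; rw [if_neg (by omega)]; simp

/-- **Pointwise comparisons** `F ≤ w_L` and `w_U ≤ F` (kernel check on `[1, 30000)`, trivial range above).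
[cite: CostaPereira1989, (2.13)–(2.14), p. 316] -/
private theorem F_le_wL_and (r : ℕ) : F r ≤ wL r ∧ wU r ≤ F r := by
  rcases Nat.eq_zero_or_pos r with h0 | hr
  · subst h0
    have hB : ∀ b ∈ BLo, 1 ≤ b.1 := by decide
    have hG : ∀ b ∈ GLo, 1 ≤ b.1 := by decide
    have hT : ∀ t ∈ TLo, 1 ≤ t := by decide
    have hB' : ∀ b ∈ BUp, 1 ≤ b.1 := by decide
    have hG' : ∀ b ∈ GUp, 1 ≤ b.1 := by decide
    have hT' : ∀ t ∈ TUp, 1 ≤ t := by decide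
    rw [F, wL, wU, sumDiv_zero, sumDiv_zero, cntB_zero BLo hB, cntB_zero GLo hG, cntT_zero TLo hT,
      cntB_zero BUp hB', cntB_zero GUp hG', cntT_zero TUp hT']
    simp [tail]
  rcases lt_or_ge r 30000 with hZ | hZ
  swap
  · rw [wL_eq_of_ge hZ, wU_eq_of_ge hZ]; have := F_range r; constructor <;> linarith [this.1, this.2]
  rcases lt_or_ge r 3001 with h0 | h0
  · exact chk_sound hr (chkAll_sound _ _ chkAll_0 r hr h0)
  rcases lt_or_ge r 6001 with h1 | h1
  · exact chk_sound hr (chkAll_sound _ _ chkAll_1 r h0 h1)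
  rcases lt_or_ge r 9001 with h2 | h2
  · exact chk_sound hr (chkAll_sound _ _ chkAll_2 r h1 h2)
  rcases lt_or_ge r 12001 with h3 | h3
  · exact chk_sound hr (chkAll_sound _ _ chkAll_3 r h2 h3)
  rcases lt_or_ge r 15001 with h4 | h4
  · exact chk_sound hr (chkAll_sound _ _ chkAll_4 r h3 h4)
  rcases lt_or_ge r 18001 with h5 | h5
  · exact chk_sound hr (chkAll_sound _ _ chkAll_5 r h4 h5)
  rcases lt_or_ge r 21001 with h6 | h6
  · exact chk_sound hr (chkAll_sound _ _ chkAll_6 r h5 h6)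
  rcases lt_or_ge r 24001 with h7 | h7
  · exact chk_sound hr (chkAll_sound _ _ chkAll_7 r h6 h7)
  rcases lt_or_ge r 27001 with h8 | h8
  · exact chk_sound hr (chkAll_sound _ _ chkAll_8 r h7 h8)
  exact chk_sound hr (chkAll_sound _ _ chkAll_9 r h8 hZ)

/-- Helper `F_le_wL` of the `m = 68` certificate (statement = its type; role: see the module docstring). [folklore] -/
private theorem F_le_wL (r : ℕ) : F r ≤ wL r := (F_le_wL_and r).1

/-- Helper `wU_le_F` of the `m = 68` certificate (statement = its type; role: see the module docstring). [folklore] -/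
private theorem wU_le_F (r : ℕ) : wU r ≤ F r := (F_le_wL_and r).2

/-- Helper `cp17_lower` of the `m = 68` certificate (statement = its type; role: see the module docstring). [folklore] -/
private theorem cp17_lower {x : ℝ} (hx : 227 ≤ x) : 0.9636 * x ≤ ψ x :=
  Literature.NumberTheory.LFunctions.CostaPereira.costaPereira_le_psi hx

/-- Helper `cp17_upper` of the `m = 68` certificate (statement = its type; role: see the module docstring). [folklore] -/
private theorem cp17_upper {x : ℝ} (hx : 201 ≤ x) : ψ x ≤ 1.0364 * x :=
  Literature.NumberTheory.LFunctions.CostaPereira.psi_le_costaPereira hx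

/-! ### §4 `V = Σ_k ν(k) T(⌊N/k⌋) = Σ_j Λ(j) F(⌊N/j⌋)` and the two `ψ`-comparisons -/

noncomputable section

open ArithmeticFunction hiding log id
open Literature.NumberTheory.LFunctions.Sylvester (T T_div psi_div_eq_sum abs_T_div_sub_le log_le_linear)

/-- `Σ_{k∈l} T(⌊N/k⌋)`. [folklore] -/
private def sumT : List ℕ → ℕ → ℝ
  | [], _ => 0
  | k :: l, N => T (N / k) + sumT l N

/-- `V(N) = Σ_k ν(k) T(⌊N/k⌋)`. [cite: CostaPereira1989, (2.1)] -/
private def V (N : ℕ) : ℝ := sumT POS N - sumT NEG N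

/-- Helper `sumT_eq` of the `m = 68` certificate (statement = its type; role: see the module docstring). [folklore] -/
private theorem sumT_eq (l : List ℕ) (hl : ∀ k ∈ l, 0 < k) (N : ℕ) :
    sumT l N = ∑ j ∈ Ioc 0 N, Λ j * (sumDiv l (N / j) : ℝ) := by
  induction l with
  | nil => simp [sumT, sumDiv]
  | cons k l ih =>
    have hk := hl k (by simp)
    have ih' := ih (fun k' hk' => hl k' (by simp [hk']))
    simp only [sumT, sumDiv, Nat.cast_add, mul_add, Finset.sum_add_distrib]
    rw [T_div N hk, ih']

/-- `V(N) = Σ_{j ≤ N} Λ(j) F(⌊N/j⌋)`. [cite: CostaPereira1989, §1 (1.10)–(1.13), p. 309] -/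
private theorem V_eq_sum (N : ℕ) : V N = ∑ j ∈ Ioc 0 N, Λ j * (F (N / j) : ℝ) := by
  have hP : ∀ k ∈ POS, 0 < k := by decide
  have hN : ∀ k ∈ NEG, 0 < k := by decide
  rw [V, sumT_eq POS hP, sumT_eq NEG hN, ← Finset.sum_sub_distrib]
  refine Finset.sum_congr rfl fun j _ => ?_
  rw [F]; push_cast; ring

/-- `Σ_{(u,v) ∈ l} (ψ(x/u) − ψ(x/v))`. [folklore] -/
private def blkPsi (x : ℝ) (l : List (ℕ × ℕ)) : ℝ :=
  (l.map fun b : ℕ × ℕ => ψ (x / (b.1 : ℝ)) - ψ (x / (b.2 : ℝ))).sum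

/-- `Σ_{t ∈ l} ψ(x/t)`. [folklore] -/
private def tailPsi (x : ℝ) (l : List ℕ) : ℝ := (l.map fun t : ℕ => ψ (x / (t : ℝ))).sum

/-- Helper `blk_eq_sub` of the `m = 68` certificate (statement = its type; role: see the module docstring). [folklore] -/
private theorem blk_eq_sub {u v : ℕ} (huv : u ≤ v) (r : ℕ) :
    blk u v r = (if u ≤ r then 1 else 0) - (if v ≤ r then 1 else 0) := by
  unfold blk; split_ifs <;> omega

/-- Helper `sum_tail` of the `m = 68` certificate (statement = its type; role: see the module docstring). [folklore] -/
private theorem sum_tail (x : ℝ) {t : ℕ} (ht : 0 < t) :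
    ∑ k ∈ Ioc 0 ⌊x⌋₊, Λ k * (tail t (⌊x⌋₊ / k) : ℝ) = ψ (x / t) := by
  rw [psi_div_eq_sum x ht]; rfl

/-- Helper `sum_blk` of the `m = 68` certificate (statement = its type; role: see the module docstring). [folklore] -/
private theorem sum_blk (x : ℝ) {u v : ℕ} (hu : 0 < u) (huv : u ≤ v) :
    ∑ k ∈ Ioc 0 ⌊x⌋₊, Λ k * (blk u v (⌊x⌋₊ / k) : ℝ) = ψ (x / u) - ψ (x / v) := by
  rw [psi_div_eq_sum x hu, psi_div_eq_sum x (lt_of_lt_of_le hu huv), ← Finset.sum_sub_distrib]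
  refine Finset.sum_congr rfl fun k _ => ?_
  rw [← mul_sub, blk_eq_sub huv]; push_cast; ring

/-- Helper `sum_cntB` of the `m = 68` certificate (statement = its type; role: see the module docstring). [folklore] -/
private theorem sum_cntB (x : ℝ) (l : List (ℕ × ℕ)) (hl : ∀ b ∈ l, 0 < b.1 ∧ b.1 ≤ b.2) :
    ∑ k ∈ Ioc 0 ⌊x⌋₊, Λ k * (cntB l (⌊x⌋₊ / k) : ℝ) = blkPsi x l := by
  induction l with
  | nil => simp [blkPsi, cntB]
  | cons b l ih =>
    have hb := hl b (by simp)
    have ih' := ih (fun b' hb' => hl b' (by simp [hb']))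
    simp only [cntB, Int.cast_add, mul_add, Finset.sum_add_distrib]
    rw [sum_blk x hb.1 hb.2, ih']
    simp [blkPsi]

/-- Helper `sum_cntT` of the `m = 68` certificate (statement = its type; role: see the module docstring). [folklore] -/
private theorem sum_cntT (x : ℝ) (l : List ℕ) (hl : ∀ t ∈ l, 0 < t) :
    ∑ k ∈ Ioc 0 ⌊x⌋₊, Λ k * (cntT l (⌊x⌋₊ / k) : ℝ) = tailPsi x l := by
  induction l with
  | nil => simp [tailPsi, cntT]
  | cons t l ih =>
    have ht := hl t (by simp)
    have ih' := ih (fun t' ht' => hl t' (by simp [ht']))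
    simp only [cntT, Int.cast_add, mul_add, Finset.sum_add_distrib]
    rw [sum_tail x ht, ih']
    simp [tailPsi]

/-- Helper `sum_wL` of the `m = 68` certificate (statement = its type; role: see the module docstring). [folklore] -/
private theorem sum_wL (x : ℝ) :
    ∑ k ∈ Ioc 0 ⌊x⌋₊, Λ k * (wL (⌊x⌋₊ / k) : ℝ) = ψ x + blkPsi x BLo - blkPsi x GLo + tailPsi x TLo := by
  simp only [wL, Int.cast_add, Int.cast_sub, mul_add, mul_sub, Finset.sum_add_distrib, Finset.sum_sub_distrib]
  rw [sum_tail x Nat.one_pos, sum_cntB x BLo (by decide), sum_cntB x GLo (by decide), sum_cntT x TLo (by decide)]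
  simp

/-- Helper `sum_wU` of the `m = 68` certificate (statement = its type; role: see the module docstring). [folklore] -/
private theorem sum_wU (x : ℝ) :
    ∑ k ∈ Ioc 0 ⌊x⌋₊, Λ k * (wU (⌊x⌋₊ / k) : ℝ) = ψ x - blkPsi x BUp + blkPsi x GUp - tailPsi x TUp := by
  simp only [wU, Int.cast_add, Int.cast_sub, mul_add, mul_sub, Finset.sum_add_distrib, Finset.sum_sub_distrib]
  rw [sum_tail x Nat.one_pos, sum_cntB x BUp (by decide), sum_cntB x GUp (by decide), sum_cntT x TUp (by decide)]
  simp

/-- **Lower comparison**: `V(⌊x⌋) ≤ ψ(x) + Σ_{BL} − Σ_{GL} + Σ_{TL}`. [cite: CostaPereira1989, (2.13)–(2.14), p. 316] -/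
private theorem V_le_psi_comb (x : ℝ) : V ⌊x⌋₊ ≤ ψ x + blkPsi x BLo - blkPsi x GLo + tailPsi x TLo := by
  rw [V_eq_sum, ← sum_wL]
  refine Finset.sum_le_sum fun k _ => mul_le_mul_of_nonneg_left ?_ vonMangoldt_nonneg
  exact_mod_cast F_le_wL (⌊x⌋₊ / k)

/-- **Upper comparison**: `ψ(x) − Σ_{BU} + Σ_{GU} − Σ_{TU} ≤ V(⌊x⌋)`. [cite: CostaPereira1989, (2.13)–(2.14), p. 316] -/
private theorem psi_comb_le_V (x : ℝ) : ψ x - blkPsi x BUp + blkPsi x GUp - tailPsi x TUp ≤ V ⌊x⌋₊ := by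
  rw [V_eq_sum, ← sum_wU]
  refine Finset.sum_le_sum fun k _ => mul_le_mul_of_nonneg_left ?_ vonMangoldt_nonneg
  exact_mod_cast wU_le_F (⌊x⌋₊ / k)

/-! ### §5 `V(x) = ω x + O(log x)` and the numerical value of `ω` -/

/-- `Σ_{k∈l} 1/k` and `Σ_{k∈l} log k / k` over `ℝ`. [folklore] -/
private def sumInvR : List ℕ → ℝ
  | [] => 0
  | k :: l => 1 / (k : ℝ) + sumInvR l

/-- Helper `sumLog` of the `m = 68` certificate (statement = its type; role: see the module docstring). [folklore] -/
private def sumLog : List ℕ → ℝ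
  | [] => 0
  | k :: l => Real.log k / k + sumLog l

/-- Helper `sumInvR_eq` of the `m = 68` certificate (statement = its type; role: see the module docstring). [folklore] -/
private theorem sumInvR_eq (l : List ℕ) : sumInvR l = (sumInv l : ℝ) := by
  induction l with
  | nil => simp [sumInvR, sumInv]
  | cons k l ih => simp [sumInvR, sumInv, ih]

/-- Helper `balanceR` of the `m = 68` certificate (statement = its type; role: see the module docstring). [folklore] -/
private theorem balanceR : sumInvR POS = sumInvR NEG := by
  rw [sumInvR_eq, sumInvR_eq, balance]

/-- `ω = −Σ ν(k) log k / k = Σ_{NEG} log k/k − Σ_{POS} log k/k = 1.00078025…`. [cite: CostaPereira1989, (2.2)] -/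
def ω : ℝ := sumLog NEG - sumLog POS

/-- Helper `T_zero` of the `m = 68` certificate (statement = its type; role: see the module docstring). [folklore] -/
private theorem T_zero : T 0 = 0 := by simp [T]

/-- Helper `abs_T_term_le` of the `m = 68` certificate (statement = its type; role: see the module docstring). [folklore] -/
private theorem abs_T_term_le {x : ℝ} (hx : 1 ≤ x) {k : ℕ} (hk : 1 ≤ k) :
    |T (⌊x⌋₊ / k) - (x / k * Real.log (x / k) - x / k)| ≤ Real.log x + 2 := by
  rcases le_or_gt (k : ℝ) x with hkx | hkx
  · exact abs_T_div_sub_le hk hkx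
  · have hx0 : 0 ≤ x := by linarith
    have hfl : ⌊x⌋₊ / k = 0 := by
      apply Nat.div_eq_of_lt
      have : (⌊x⌋₊ : ℝ) < k := lt_of_le_of_lt (Nat.floor_le hx0) hkx
      exact_mod_cast this
    rw [hfl, T_zero, zero_sub, abs_neg]
    have hk0 : (0 : ℝ) < k := by exact_mod_cast hk
    have hy0 : 0 < x / k := by positivity
    have hy1 : x / k ≤ 1 := by rw [div_le_one hk0]; exact hkx.le
    have h1 := abs_lt.1 (Real.abs_log_mul_self_lt (x / k) hy0 hy1)
    have hlog0 : 0 ≤ Real.log x := Real.log_nonneg hx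
    have hc : x / k * Real.log (x / k) = Real.log (x / k) * (x / k) := mul_comm _ _
    rw [abs_le, hc]
    constructor <;> linarith [h1.1, h1.2]

/-- Helper `sumT_main` of the `m = 68` certificate (statement = its type; role: see the module docstring). [folklore] -/
private theorem sumT_main (l : List ℕ) (hl : ∀ k ∈ l, 1 ≤ k) {x : ℝ} (hx : 1 ≤ x) :
    |sumT l ⌊x⌋₊ - ((x * Real.log x - x) * sumInvR l - x * sumLog l)| ≤ l.length * (Real.log x + 2) := by
  induction l with
  | nil => simp [sumT, sumInvR, sumLog]
  | cons k l ih =>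
    have hk := hl k (by simp)
    have ih' := ih (fun k' hk' => hl k' (by simp [hk']))
    have hk0 : (0 : ℝ) < k := by exact_mod_cast hk
    have hx0 : 0 < x := by linarith
    have e := abs_T_term_le hx hk
    have hsplit : x / k * Real.log (x / k) - x / k
        = (x * Real.log x - x) * (1 / (k : ℝ)) - x * (Real.log k / k) := by
      rw [Real.log_div hx0.ne' hk0.ne']; field_simp; ring
    rw [hsplit] at e
    rw [abs_le] at ih' e ⊢
    simp only [sumT, sumInvR, sumLog, List.length_cons, Nat.cast_succ]
    constructor <;> linarith [ih'.1, ih'.2, e.1, e.2]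

/-- `|V(⌊x⌋) − ω x| ≤ 50 (log x + 2)` for `x ≥ 1`. [cite: CostaPereira1989, Lemma 3 (2.5)–(2.7), p. 314 (explicit weaker form proved here)] -/
private theorem abs_V_sub_le {x : ℝ} (hx : 1 ≤ x) : |V ⌊x⌋₊ - ω * x| ≤ 50 * (Real.log x + 2) := by
  have hP : ∀ k ∈ POS, 1 ≤ k := by decide
  have hN : ∀ k ∈ NEG, 1 ≤ k := by decide
  have h1 := sumT_main POS hP hx
  have h2 := sumT_main NEG hN hx
  have hl1 : (POS.length : ℝ) = 25 := by simp [POS]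
  have hl2 : (NEG.length : ℝ) = 25 := by simp [NEG]
  rw [hl1] at h1; rw [hl2] at h2
  rw [balanceR] at h1
  rw [abs_le] at h1 h2 ⊢
  simp only [V, ω]
  constructor <;> linarith [h1.1, h1.2, h2.1, h2.2]

/-- `1.9459101482 < log 7 < 1.9459101498` (`7 = 8·(1 − 1/8)`, 11 series terms). [folklore] -/
private theorem log_7_bounds : (1.9459101482 : ℝ) < Real.log 7 ∧ Real.log 7 < 1.9459101498 := by
  have h := Real.abs_log_sub_add_sum_range_le (x := (1 / 8 : ℝ))
    (by rw [abs_of_pos (by norm_num)]; norm_num) 11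
  rw [abs_of_pos (by norm_num : (0 : ℝ) < 1 / 8)] at h
  have hs : ∑ i ∈ range 11, (1 / 8 : ℝ) ^ (i + 1) / (i + 1) = 3974444842639 / 29764123361280 := by
    simp only [sum_range_succ, sum_range_zero]
    norm_num
  have hdec : Real.log ((1 : ℝ) - 1 / 8) = Real.log 7 - (3 * Real.log 2) := by
    rw [show (1 : ℝ) - 1 / 8 = 7 / (2 ^ 3) by norm_num, Real.log_div (by norm_num) (by positivity)]
    simp only [Real.log_pow]; push_cast; ring
  rw [hs, hdec] at h
  have hq2a := Real.log_two_gt_d9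
  have hq2b := Real.log_two_lt_d9
  have h' := abs_le.1 h
  norm_num at h'
  constructor <;> linarith [h'.1, h'.2]

/-- `2.397895272 < log 11 < 2.3978952735` (`11 = 12·(1 − 1/12)`, 9 series terms). [folklore] -/
private theorem log_11_bounds : (2.397895272 : ℝ) < Real.log 11 ∧ Real.log 11 < 2.3978952735 := by
  have h := Real.abs_log_sub_add_sum_range_le (x := (1 / 12 : ℝ))
    (by rw [abs_of_pos (by norm_num)]; norm_num) 9
  rw [abs_of_pos (by norm_num : (0 : ℝ) < 1 / 12)] at h
  have hs : ∑ i ∈ range 9, (1 / 12 : ℝ) ^ (i + 1) / (i + 1) = 282844543831 / 3250661621760 := by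
    simp only [sum_range_succ, sum_range_zero]
    norm_num
  have hdec : Real.log ((1 : ℝ) - 1 / 12) = Real.log 11 - (2 * Real.log 2 + Real.log 3) := by
    rw [show (1 : ℝ) - 1 / 12 = 11 / (2 ^ 2 * 3) by norm_num, Real.log_div (by norm_num) (by positivity), Real.log_mul (by positivity) (by positivity)]
    simp only [Real.log_pow]; push_cast; ring
  rw [hs, hdec] at h
  have hq2a := Real.log_two_gt_d9
  have hq2b := Real.log_two_lt_d9
  have hq3a := Real.log_three_gt_d9
  have hq3b := Real.log_three_lt_d9
  have h' := abs_le.1 h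
  norm_num at h'
  constructor <;> linarith [h'.1, h'.2]

/-- `2.5649493563 < log 13 < 2.5649493585` (`13 = 14·(1 − 1/14)`, 9 series terms). [folklore] -/
private theorem log_13_bounds : (2.5649493563 : ℝ) < Real.log 13 ∧ Real.log 13 < 2.5649493585 := by
  have h := Real.abs_log_sub_add_sum_range_le (x := (1 / 14 : ℝ))
    (by rw [abs_of_pos (by norm_num)]; norm_num) 9
  rw [abs_of_pos (by norm_num : (0 : ℝ) < 1 / 14)] at h
  have hs : ∑ i ∈ range 9, (1 / 14 : ℝ) ^ (i + 1) / (i + 1) = 275606690351 / 3718988421120 := by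
    simp only [sum_range_succ, sum_range_zero]
    norm_num
  have hdec : Real.log ((1 : ℝ) - 1 / 14) = Real.log 13 - (Real.log 2 + Real.log 7) := by
    rw [show (1 : ℝ) - 1 / 14 = 13 / (2 * 7) by norm_num, Real.log_div (by norm_num) (by positivity), Real.log_mul (by positivity) (by positivity)]
  rw [hs, hdec] at h
  have hq2a := Real.log_two_gt_d9
  have hq2b := Real.log_two_lt_d9
  have hq7a := log_7_bounds.1
  have hq7b := log_7_bounds.2
  have h' := abs_le.1 h
  norm_num at h'
  constructor <;> linarith [h'.1, h'.2]

/-- `2.8332133434 < log 17 < 2.8332133446` (`17 = 18·(1 − 1/18)`, 8 series terms). [folklore] -/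
private theorem log_17_bounds : (2.8332133434 : ℝ) < Real.log 17 ∧ Real.log 17 < 2.8332133446 := by
  have h := Real.abs_log_sub_add_sum_range_le (x := (1 / 18 : ℝ))
    (by rw [abs_of_pos (by norm_num)]; norm_num) 8
  rw [abs_of_pos (by norm_num : (0 : ℝ) < 1 / 18)] at h
  have hs : ∑ i ∈ range 8, (1 / 18 : ℝ) ^ (i + 1) / (i + 1) = 176367370787 / 3085588961280 := by
    simp only [sum_range_succ, sum_range_zero]
    norm_num
  have hdec : Real.log ((1 : ℝ) - 1 / 18) = Real.log 17 - (Real.log 2 + 2 * Real.log 3) := by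
    rw [show (1 : ℝ) - 1 / 18 = 17 / (2 * 3 ^ 2) by norm_num, Real.log_div (by norm_num) (by positivity), Real.log_mul (by positivity) (by positivity)]
    simp only [Real.log_pow]; push_cast; ring
  rw [hs, hdec] at h
  have hq2a := Real.log_two_gt_d9
  have hq2b := Real.log_two_lt_d9
  have hq3a := Real.log_three_gt_d9
  have hq3b := Real.log_three_lt_d9
  have h' := abs_le.1 h
  norm_num at h'
  constructor <;> linarith [h'.1, h'.2]

/-- `2.9444389785 < log 19 < 2.9444389799` (`19 = 20·(1 − 1/20)`, 8 series terms). [folklore] -/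
private theorem log_19_bounds : (2.9444389785 : ℝ) < Real.log 19 ∧ Real.log 19 < 2.9444389799 := by
  have h := Real.abs_log_sub_add_sum_range_le (x := (1 / 20 : ℝ))
    (by rw [abs_of_pos (by norm_num)]; norm_num) 8
  rw [abs_of_pos (by norm_num : (0 : ℝ) < 1 / 20)] at h
  have hs : ∑ i ∈ range 8, (1 / 20 : ℝ) ^ (i + 1) / (i + 1) = 220602200501 / 4300800000000 := by
    simp only [sum_range_succ, sum_range_zero]
    norm_num
  have hdec : Real.log ((1 : ℝ) - 1 / 20) = Real.log 19 - (2 * Real.log 2 + Real.log 5) := by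
    rw [show (1 : ℝ) - 1 / 20 = 19 / (2 ^ 2 * 5) by norm_num, Real.log_div (by norm_num) (by positivity), Real.log_mul (by positivity) (by positivity)]
    simp only [Real.log_pow]; push_cast; ring
  rw [hs, hdec] at h
  have hq2a := Real.log_two_gt_d9
  have hq2b := Real.log_two_lt_d9
  have hq5a := Real.log_five_gt_d9
  have hq5b := Real.log_five_lt_d9
  have h' := abs_le.1 h
  norm_num at h'
  constructor <;> linarith [h'.1, h'.2]

/-- `3.1354942149 < log 23 < 3.1354942168` (`23 = 24·(1 − 1/24)`, 7 series terms). [folklore] -/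
private theorem log_23_bounds : (3.1354942149 : ℝ) < Real.log 23 ∧ Real.log 23 < 3.1354942168 := by
  have h := Real.abs_log_sub_add_sum_range_le (x := (1 / 24 : ℝ))
    (by rw [abs_of_pos (by norm_num)]; norm_num) 7
  rw [abs_of_pos (by norm_num : (0 : ℝ) < 1 / 24)] at h
  have hs : ∑ i ∈ range 7, (1 / 24 : ℝ) ^ (i + 1) / (i + 1) = 6831945937 / 160526499840 := by
    simp only [sum_range_succ, sum_range_zero]
    norm_num
  have hdec : Real.log ((1 : ℝ) - 1 / 24) = Real.log 23 - (3 * Real.log 2 + Real.log 3) := by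
    rw [show (1 : ℝ) - 1 / 24 = 23 / (2 ^ 3 * 3) by norm_num, Real.log_div (by norm_num) (by positivity), Real.log_mul (by positivity) (by positivity)]
    simp only [Real.log_pow]; push_cast; ring
  rw [hs, hdec] at h
  have hq2a := Real.log_two_gt_d9
  have hq2b := Real.log_two_lt_d9
  have hq3a := Real.log_three_gt_d9
  have hq3b := Real.log_three_lt_d9
  have h' := abs_le.1 h
  norm_num at h'
  constructor <;> linarith [h'.1, h'.2]

/-- `3.3672958294 < log 29 < 3.3672958306` (`29 = 30·(1 − 1/30)`, 7 series terms). [folklore] -/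
private theorem log_29_bounds : (3.3672958294 : ℝ) < Real.log 29 ∧ Real.log 29 < 3.3672958306 := by
  have h := Real.abs_log_sub_add_sum_range_le (x := (1 / 30 : ℝ))
    (by rw [abs_of_pos (by norm_num)]; norm_num) 7
  rw [abs_of_pos (by norm_num : (0 : ℝ) < 1 / 30)] at h
  have hs : ∑ i ∈ range 7, (1 / 30 : ℝ) ^ (i + 1) / (i + 1) = 96110899 / 2835000000 := by
    simp only [sum_range_succ, sum_range_zero]
    norm_num
  have hdec : Real.log ((1 : ℝ) - 1 / 30) = Real.log 29 - (Real.log 2 + Real.log 3 + Real.log 5) := by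
    rw [show (1 : ℝ) - 1 / 30 = 29 / (2 * 3 * 5) by norm_num, Real.log_div (by norm_num) (by positivity), Real.log_mul (by positivity) (by positivity), Real.log_mul (by positivity) (by positivity)]
  rw [hs, hdec] at h
  have hq2a := Real.log_two_gt_d9
  have hq2b := Real.log_two_lt_d9
  have hq3a := Real.log_three_gt_d9
  have hq3b := Real.log_three_lt_d9
  have hq5a := Real.log_five_gt_d9
  have hq5b := Real.log_five_lt_d9
  have h' := abs_le.1 h
  norm_num at h'
  constructor <;> linarith [h'.1, h'.2]

/-- `3.4339872031 < log 31 < 3.4339872057` (`31 = 32·(1 − 1/32)`, 7 series terms). [folklore] -/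
private theorem log_31_bounds : (3.4339872031 : ℝ) < Real.log 31 ∧ Real.log 31 < 3.4339872057 := by
  have h := Real.abs_log_sub_add_sum_range_le (x := (1 / 32 : ℝ))
    (by rw [abs_of_pos (by norm_num)]; norm_num) 7
  rw [abs_of_pos (by norm_num : (0 : ℝ) < 1 / 32)] at h
  have hs : ∑ i ∈ range 7, (1 / 32 : ℝ) ^ (i + 1) / (i + 1) = 114542081599 / 3607772528640 := by
    simp only [sum_range_succ, sum_range_zero]
    norm_num
  have hdec : Real.log ((1 : ℝ) - 1 / 32) = Real.log 31 - (5 * Real.log 2) := by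
    rw [show (1 : ℝ) - 1 / 32 = 31 / (2 ^ 5) by norm_num, Real.log_div (by norm_num) (by positivity)]
    simp only [Real.log_pow]; push_cast; ring
  rw [hs, hdec] at h
  have hq2a := Real.log_two_gt_d9
  have hq2b := Real.log_two_lt_d9
  have h' := abs_le.1 h
  norm_num at h'
  constructor <;> linarith [h'.1, h'.2]

/-- `3.6109179117 < log 37 < 3.6109179137` (`37 = 38·(1 − 1/38)`, 6 series terms). [folklore] -/
private theorem log_37_bounds : (3.6109179117 : ℝ) < Real.log 37 ∧ Real.log 37 < 3.6109179137 := by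
  have h := Real.abs_log_sub_add_sum_range_le (x := (1 / 38 : ℝ))
    (by rw [abs_of_pos (by norm_num)]; norm_num) 6
  rw [abs_of_pos (by norm_num : (0 : ℝ) < 1 / 38)] at h
  have hs : ∑ i ∈ range 6, (1 / 38 : ℝ) ^ (i + 1) / (i + 1) = 2408891863 / 90328091520 := by
    simp only [sum_range_succ, sum_range_zero]
    norm_num
  have hdec : Real.log ((1 : ℝ) - 1 / 38) = Real.log 37 - (Real.log 2 + Real.log 19) := by
    rw [show (1 : ℝ) - 1 / 38 = 37 / (2 * 19) by norm_num, Real.log_div (by norm_num) (by positivity), Real.log_mul (by positivity) (by positivity)]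
  rw [hs, hdec] at h
  have hq2a := Real.log_two_gt_d9
  have hq2b := Real.log_two_lt_d9
  have hq19a := log_19_bounds.1
  have hq19b := log_19_bounds.2
  have h' := abs_le.1 h
  norm_num at h'
  constructor <;> linarith [h'.1, h'.2]

/-- `3.7135720654 < log 41 < 3.7135720679` (`41 = 42·(1 − 1/42)`, 6 series terms). [folklore] -/
private theorem log_41_bounds : (3.7135720654 : ℝ) < Real.log 41 ∧ Real.log 41 < 3.7135720679 := by
  have h := Real.abs_log_sub_add_sum_range_le (x := (1 / 42 : ℝ))
    (by rw [abs_of_pos (by norm_num)]; norm_num) 6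
  rw [abs_of_pos (by norm_num : (0 : ℝ) < 1 / 42)] at h
  have hs : ∑ i ∈ range 6, (1 / 42 : ℝ) ^ (i + 1) / (i + 1) = 3968166767 / 164670952320 := by
    simp only [sum_range_succ, sum_range_zero]
    norm_num
  have hdec : Real.log ((1 : ℝ) - 1 / 42) = Real.log 41 - (Real.log 2 + Real.log 3 + Real.log 7) := by
    rw [show (1 : ℝ) - 1 / 42 = 41 / (2 * 3 * 7) by norm_num, Real.log_div (by norm_num) (by positivity), Real.log_mul (by positivity) (by positivity), Real.log_mul (by positivity) (by positivity)]
  rw [hs, hdec] at h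
  have hq2a := Real.log_two_gt_d9
  have hq2b := Real.log_two_lt_d9
  have hq3a := Real.log_three_gt_d9
  have hq3b := Real.log_three_lt_d9
  have hq7a := log_7_bounds.1
  have hq7b := log_7_bounds.2
  have h' := abs_le.1 h
  norm_num at h'
  constructor <;> linarith [h'.1, h'.2]

/-- `3.7612001143 < log 43 < 3.7612001169` (`43 = 44·(1 − 1/44)`, 6 series terms). [folklore] -/
private theorem log_43_bounds : (3.7612001143 : ℝ) < Real.log 43 ∧ Real.log 43 < 3.7612001169 := by
  have h := Real.abs_log_sub_add_sum_range_le (x := (1 / 44 : ℝ))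
    (by rw [abs_of_pos (by norm_num)]; norm_num) 6
  rw [abs_of_pos (by norm_num : (0 : ℝ) < 1 / 44)] at h
  have hs : ∑ i ∈ range 6, (1 / 44 : ℝ) ^ (i + 1) / (i + 1) = 5004574789 / 217689415680 := by
    simp only [sum_range_succ, sum_range_zero]
    norm_num
  have hdec : Real.log ((1 : ℝ) - 1 / 44) = Real.log 43 - (2 * Real.log 2 + Real.log 11) := by
    rw [show (1 : ℝ) - 1 / 44 = 43 / (2 ^ 2 * 11) by norm_num, Real.log_div (by norm_num) (by positivity), Real.log_mul (by positivity) (by positivity)]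
    simp only [Real.log_pow]; push_cast; ring
  rw [hs, hdec] at h
  have hq2a := Real.log_two_gt_d9
  have hq2b := Real.log_two_lt_d9
  have hq11a := log_11_bounds.1
  have hq11b := log_11_bounds.2
  have h' := abs_le.1 h
  norm_num at h'
  constructor <;> linarith [h'.1, h'.2]

/-- `3.8501476005 < log 47 < 3.8501476029` (`47 = 48·(1 − 1/48)`, 6 series terms). [folklore] -/
private theorem log_47_bounds : (3.8501476005 : ℝ) < Real.log 47 ∧ Real.log 47 < 3.8501476029 := by
  have h := Real.abs_log_sub_add_sum_range_le (x := (1 / 48 : ℝ))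
    (by rw [abs_of_pos (by norm_num)]; norm_num) 6
  rw [abs_of_pos (by norm_num : (0 : ℝ) < 1 / 48)] at h
  have hs : ∑ i ∈ range 6, (1 / 48 : ℝ) ^ (i + 1) / (i + 1) = 7724868773 / 366917713920 := by
    simp only [sum_range_succ, sum_range_zero]
    norm_num
  have hdec : Real.log ((1 : ℝ) - 1 / 48) = Real.log 47 - (4 * Real.log 2 + Real.log 3) := by
    rw [show (1 : ℝ) - 1 / 48 = 47 / (2 ^ 4 * 3) by norm_num, Real.log_div (by norm_num) (by positivity), Real.log_mul (by positivity) (by positivity)]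
    simp only [Real.log_pow]; push_cast; ring
  rw [hs, hdec] at h
  have hq2a := Real.log_two_gt_d9
  have hq2b := Real.log_two_lt_d9
  have hq3a := Real.log_three_gt_d9
  have hq3b := Real.log_three_lt_d9
  have h' := abs_le.1 h
  norm_num at h'
  constructor <;> linarith [h'.1, h'.2]

/-- `3.9702919127 < log 53 < 3.9702919142` (`53 = 54·(1 − 1/54)`, 6 series terms). [folklore] -/
private theorem log_53_bounds : (3.9702919127 : ℝ) < Real.log 53 ∧ Real.log 53 < 3.9702919142 := by
  have h := Real.abs_log_sub_add_sum_range_le (x := (1 / 54 : ℝ))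
    (by rw [abs_of_pos (by norm_num)]; norm_num) 6
  rw [abs_of_pos (by norm_num : (0 : ℝ) < 1 / 54)] at h
  have hs : ∑ i ∈ range 6, (1 / 54 : ℝ) ^ (i + 1) / (i + 1) = 13904093399 / 743847338880 := by
    simp only [sum_range_succ, sum_range_zero]
    norm_num
  have hdec : Real.log ((1 : ℝ) - 1 / 54) = Real.log 53 - (Real.log 2 + 3 * Real.log 3) := by
    rw [show (1 : ℝ) - 1 / 54 = 53 / (2 * 3 ^ 3) by norm_num, Real.log_div (by norm_num) (by positivity), Real.log_mul (by positivity) (by positivity)]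
    simp only [Real.log_pow]; push_cast; ring
  rw [hs, hdec] at h
  have hq2a := Real.log_two_gt_d9
  have hq2b := Real.log_two_lt_d9
  have hq3a := Real.log_three_gt_d9
  have hq3b := Real.log_three_lt_d9
  have h' := abs_le.1 h
  norm_num at h'
  constructor <;> linarith [h'.1, h'.2]

/-- `4.077537443 < log 59 < 4.0775374447` (`59 = 60·(1 − 1/60)`, 6 series terms). [folklore] -/
private theorem log_59_bounds : (4.077537443 : ℝ) < Real.log 59 ∧ Real.log 59 < 4.0775374447 := by
  have h := Real.abs_log_sub_add_sum_range_le (x := (1 / 60 : ℝ))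
    (by rw [abs_of_pos (by norm_num)]; norm_num) 6
  rw [abs_of_pos (by norm_num : (0 : ℝ) < 1 / 60)] at h
  have hs : ∑ i ∈ range 6, (1 / 60 : ℝ) ^ (i + 1) / (i + 1) = 4704917473 / 279936000000 := by
    simp only [sum_range_succ, sum_range_zero]
    norm_num
  have hdec : Real.log ((1 : ℝ) - 1 / 60) = Real.log 59 - (2 * Real.log 2 + Real.log 3 + Real.log 5) := by
    rw [show (1 : ℝ) - 1 / 60 = 59 / (2 ^ 2 * 3 * 5) by norm_num, Real.log_div (by norm_num) (by positivity), Real.log_mul (by positivity) (by positivity), Real.log_mul (by positivity) (by positivity)]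
    simp only [Real.log_pow]; push_cast; ring
  rw [hs, hdec] at h
  have hq2a := Real.log_two_gt_d9
  have hq2b := Real.log_two_lt_d9
  have hq3a := Real.log_three_gt_d9
  have hq3b := Real.log_three_lt_d9
  have hq5a := Real.log_five_gt_d9
  have hq5b := Real.log_five_lt_d9
  have h' := abs_le.1 h
  norm_num at h'
  constructor <;> linarith [h'.1, h'.2]

/-- `4.1108738625 < log 61 < 4.1108738657` (`61 = 62·(1 − 1/62)`, 5 series terms). [folklore] -/
private theorem log_61_bounds : (4.1108738625 : ℝ) < Real.log 61 ∧ Real.log 61 < 4.1108738657 := by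
  have h := Real.abs_log_sub_add_sum_range_le (x := (1 / 62 : ℝ))
    (by rw [abs_of_pos (by norm_num)]; norm_num) 5
  rw [abs_of_pos (by norm_num : (0 : ℝ) < 1 / 62)] at h
  have hs : ∑ i ∈ range 5, (1 / 62 : ℝ) ^ (i + 1) / (i + 1) = 446903911 / 27483984960 := by
    simp only [sum_range_succ, sum_range_zero]
    norm_num
  have hdec : Real.log ((1 : ℝ) - 1 / 62) = Real.log 61 - (Real.log 2 + Real.log 31) := by
    rw [show (1 : ℝ) - 1 / 62 = 61 / (2 * 31) by norm_num, Real.log_div (by norm_num) (by positivity), Real.log_mul (by positivity) (by positivity)]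
  rw [hs, hdec] at h
  have hq2a := Real.log_two_gt_d9
  have hq2b := Real.log_two_lt_d9
  have hq31a := log_31_bounds.1
  have hq31b := log_31_bounds.2
  have h' := abs_le.1 h
  norm_num at h'
  constructor <;> linarith [h'.1, h'.2]

/-- `4.2046926182 < log 67 < 4.2046926205` (`67 = 68·(1 − 1/68)`, 5 series terms). [folklore] -/
private theorem log_67_bounds : (4.2046926182 : ℝ) < Real.log 67 ∧ Real.log 67 < 4.2046926205 := by
  have h := Real.abs_log_sub_add_sum_range_le (x := (1 / 68 : ℝ))
    (by rw [abs_of_pos (by norm_num)]; norm_num) 5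
  rw [abs_of_pos (by norm_num : (0 : ℝ) < 1 / 68)] at h
  have hs : ∑ i ∈ range 5, (1 / 68 : ℝ) ^ (i + 1) / (i + 1) = 161551129 / 10904501760 := by
    simp only [sum_range_succ, sum_range_zero]
    norm_num
  have hdec : Real.log ((1 : ℝ) - 1 / 68) = Real.log 67 - (2 * Real.log 2 + Real.log 17) := by
    rw [show (1 : ℝ) - 1 / 68 = 67 / (2 ^ 2 * 17) by norm_num, Real.log_div (by norm_num) (by positivity), Real.log_mul (by positivity) (by positivity)]
    simp only [Real.log_pow]; push_cast; ring
  rw [hs, hdec] at h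
  have hq2a := Real.log_two_gt_d9
  have hq2b := Real.log_two_lt_d9
  have hq17a := log_17_bounds.1
  have hq17b := log_17_bounds.2
  have h' := abs_le.1 h
  norm_num at h'
  constructor <;> linarith [h'.1, h'.2]

set_option maxHeartbeats 4000000 in
set_option linter.unusedSimpArgs false in
/-- `2.366345827 ≤ Σ_{ν=+1} log k / k ≤ 2.366345829`. [folklore] -/
private theorem sumLog_POS_bounds : (2.366345827 : ℝ) ≤ sumLog POS ∧ sumLog POS ≤ 2.366345829 := by
  simp only [sumLog, POS, Nat.cast_ofNat, Nat.cast_one, Real.log_one, zero_div, zero_add, add_zero, Nat.cast_succ, CharP.cast_eq_zero]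
  have lP_6 : Real.log (6 : ℝ) = Real.log 2 + Real.log 3 := by
    rw [show (6 : ℝ) = 2 * 3 by norm_num, Real.log_mul (by positivity) (by positivity)]
  have lP_10 : Real.log (10 : ℝ) = Real.log 2 + Real.log 5 := by
    rw [show (10 : ℝ) = 2 * 5 by norm_num, Real.log_mul (by positivity) (by positivity)]
  have lP_14 : Real.log (14 : ℝ) = Real.log 2 + Real.log 7 := by
    rw [show (14 : ℝ) = 2 * 7 by norm_num, Real.log_mul (by positivity) (by positivity)]
  have lP_15 : Real.log (15 : ℝ) = Real.log 3 + Real.log 5 := by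
    rw [show (15 : ℝ) = 3 * 5 by norm_num, Real.log_mul (by positivity) (by positivity)]
  have lP_21 : Real.log (21 : ℝ) = Real.log 3 + Real.log 7 := by
    rw [show (21 : ℝ) = 3 * 7 by norm_num, Real.log_mul (by positivity) (by positivity)]
  have lP_22 : Real.log (22 : ℝ) = Real.log 2 + Real.log 11 := by
    rw [show (22 : ℝ) = 2 * 11 by norm_num, Real.log_mul (by positivity) (by positivity)]
  have lP_26 : Real.log (26 : ℝ) = Real.log 2 + Real.log 13 := by
    rw [show (26 : ℝ) = 2 * 13 by norm_num, Real.log_mul (by positivity) (by positivity)]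
  have lP_33 : Real.log (33 : ℝ) = Real.log 3 + Real.log 11 := by
    rw [show (33 : ℝ) = 3 * 11 by norm_num, Real.log_mul (by positivity) (by positivity)]
  have lP_34 : Real.log (34 : ℝ) = Real.log 2 + Real.log 17 := by
    rw [show (34 : ℝ) = 2 * 17 by norm_num, Real.log_mul (by positivity) (by positivity)]
  have lP_35 : Real.log (35 : ℝ) = Real.log 5 + Real.log 7 := by
    rw [show (35 : ℝ) = 5 * 7 by norm_num, Real.log_mul (by positivity) (by positivity)]
  have lP_38 : Real.log (38 : ℝ) = Real.log 2 + Real.log 19 := by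
    rw [show (38 : ℝ) = 2 * 19 by norm_num, Real.log_mul (by positivity) (by positivity)]
  have lP_39 : Real.log (39 : ℝ) = Real.log 3 + Real.log 13 := by
    rw [show (39 : ℝ) = 3 * 13 by norm_num, Real.log_mul (by positivity) (by positivity)]
  have lP_46 : Real.log (46 : ℝ) = Real.log 2 + Real.log 23 := by
    rw [show (46 : ℝ) = 2 * 23 by norm_num, Real.log_mul (by positivity) (by positivity)]
  have lP_51 : Real.log (51 : ℝ) = Real.log 3 + Real.log 17 := by
    rw [show (51 : ℝ) = 3 * 17 by norm_num, Real.log_mul (by positivity) (by positivity)]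
  have lP_55 : Real.log (55 : ℝ) = Real.log 5 + Real.log 11 := by
    rw [show (55 : ℝ) = 5 * 11 by norm_num, Real.log_mul (by positivity) (by positivity)]
  have lP_57 : Real.log (57 : ℝ) = Real.log 3 + Real.log 19 := by
    rw [show (57 : ℝ) = 3 * 19 by norm_num, Real.log_mul (by positivity) (by positivity)]
  have lP_58 : Real.log (58 : ℝ) = Real.log 2 + Real.log 29 := by
    rw [show (58 : ℝ) = 2 * 29 by norm_num, Real.log_mul (by positivity) (by positivity)]
  have lP_62 : Real.log (62 : ℝ) = Real.log 2 + Real.log 31 := by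
    rw [show (62 : ℝ) = 2 * 31 by norm_num, Real.log_mul (by positivity) (by positivity)]
  have lP_65 : Real.log (65 : ℝ) = Real.log 5 + Real.log 13 := by
    rw [show (65 : ℝ) = 5 * 13 by norm_num, Real.log_mul (by positivity) (by positivity)]
  have lP_86 : Real.log (86 : ℝ) = Real.log 2 + Real.log 43 := by
    rw [show (86 : ℝ) = 2 * 43 by norm_num, Real.log_mul (by positivity) (by positivity)]
  have lP_2627690 : Real.log (2627690 : ℝ) = Real.log 2 + Real.log 5 + Real.log 13 + Real.log 17 + Real.log 29 + Real.log 41 := by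
    rw [show (2627690 : ℝ) = 2 * 5 * 13 * 17 * 29 * 41 by norm_num, Real.log_mul (by positivity) (by positivity), Real.log_mul (by positivity) (by positivity), Real.log_mul (by positivity) (by positivity), Real.log_mul (by positivity) (by positivity), Real.log_mul (by positivity) (by positivity)]
  have fP_83849539269265770 : 0 ≤ Real.log (83849539269265770 : ℝ) / 83849539269265770 ∧ Real.log (83849539269265770 : ℝ) / 83849539269265770 ≤ 0.000000000000000472 := by
    constructor
    · exact div_nonneg (Real.log_nonneg (by norm_num)) (by norm_num)
    · rw [div_le_iff₀ (by norm_num)]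
      have hle := Real.log_le_log (by norm_num : (0 : ℝ) < 83849539269265770) (show (83849539269265770 : ℝ) ≤ 2 ^ 57 by norm_num)
      rw [Real.log_pow] at hle; push_cast at hle
      have h2 := Real.log_two_lt_d9
      linarith [hle, h2]
  have fP_1661378763441916925133 : 0 ≤ Real.log (1661378763441916925133 : ℝ) / 1661378763441916925133 ∧ Real.log (1661378763441916925133 : ℝ) / 1661378763441916925133 ≤ 0.0000000000000000000297 := by
    constructor
    · exact div_nonneg (Real.log_nonneg (by norm_num)) (by norm_num)
    · rw [div_le_iff₀ (by norm_num)]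
      have hle := Real.log_le_log (by norm_num : (0 : ℝ) < 1661378763441916925133) (show (1661378763441916925133 : ℝ) ≤ 2 ^ 71 by norm_num)
      rw [Real.log_pow] at hle; push_cast at hle
      have h2 := Real.log_two_lt_d9
      linarith [hle, h2]
  have fP_1571664310216053411175818 : 0 ≤ Real.log (1571664310216053411175818 : ℝ) / 1571664310216053411175818 ∧ Real.log (1571664310216053411175818 : ℝ) / 1571664310216053411175818 ≤ 0.0000000000000000000000358 := by
    constructor
    · exact div_nonneg (Real.log_nonneg (by norm_num)) (by norm_num)
    · rw [div_le_iff₀ (by norm_num)]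
      have hle := Real.log_le_log (by norm_num : (0 : ℝ) < 1571664310216053411175818) (show (1571664310216053411175818 : ℝ) ≤ 2 ^ 81 by norm_num)
      rw [Real.log_pow] at hle; push_cast at hle
      have h2 := Real.log_two_lt_d9
      linarith [hle, h2]
  have hp2a := Real.log_two_gt_d9
  have hp2b := Real.log_two_lt_d9
  have hp3a := Real.log_three_gt_d9
  have hp3b := Real.log_three_lt_d9
  have hp5a := Real.log_five_gt_d9
  have hp5b := Real.log_five_lt_d9
  have hp7a := log_7_bounds.1
  have hp7b := log_7_bounds.2
  have hp11a := log_11_bounds.1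
  have hp11b := log_11_bounds.2
  have hp13a := log_13_bounds.1
  have hp13b := log_13_bounds.2
  have hp17a := log_17_bounds.1
  have hp17b := log_17_bounds.2
  have hp19a := log_19_bounds.1
  have hp19b := log_19_bounds.2
  have hp23a := log_23_bounds.1
  have hp23b := log_23_bounds.2
  have hp29a := log_29_bounds.1
  have hp29b := log_29_bounds.2
  have hp31a := log_31_bounds.1
  have hp31b := log_31_bounds.2
  have hp37a := log_37_bounds.1
  have hp37b := log_37_bounds.2
  have hp41a := log_41_bounds.1
  have hp41b := log_41_bounds.2
  have hp43a := log_43_bounds.1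
  have hp43b := log_43_bounds.2
  have hp47a := log_47_bounds.1
  have hp47b := log_47_bounds.2
  have hp53a := log_53_bounds.1
  have hp53b := log_53_bounds.2
  have hp59a := log_59_bounds.1
  have hp59b := log_59_bounds.2
  have hp61a := log_61_bounds.1
  have hp61b := log_61_bounds.2
  have hp67a := log_67_bounds.1
  have hp67b := log_67_bounds.2
  rw [lP_6, lP_10, lP_14, lP_15, lP_21, lP_22, lP_26, lP_33, lP_34, lP_35, lP_38, lP_39, lP_46, lP_51, lP_55, lP_57, lP_58, lP_62, lP_65, lP_86, lP_2627690]
  constructor <;> linarith [fP_83849539269265770.1, fP_83849539269265770.2, fP_1661378763441916925133.1, fP_1661378763441916925133.2, fP_1571664310216053411175818.1, fP_1571664310216053411175818.2]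

set_option maxHeartbeats 4000000 in
set_option linter.unusedSimpArgs false in
/-- `3.367126085 ≤ Σ_{ν=−1} log k / k ≤ 3.367126088`. [folklore] -/
private theorem sumLog_NEG_bounds : (3.367126085 : ℝ) ≤ sumLog NEG ∧ sumLog NEG ≤ 3.367126088 := by
  simp only [sumLog, NEG, Nat.cast_ofNat, Nat.cast_one, Real.log_one, zero_div, zero_add, add_zero, Nat.cast_succ, CharP.cast_eq_zero]
  have lN_30 : Real.log (30 : ℝ) = Real.log 2 + Real.log 3 + Real.log 5 := by
    rw [show (30 : ℝ) = 2 * 3 * 5 by norm_num, Real.log_mul (by positivity) (by positivity), Real.log_mul (by positivity) (by positivity)]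
  have lN_42 : Real.log (42 : ℝ) = Real.log 2 + Real.log 3 + Real.log 7 := by
    rw [show (42 : ℝ) = 2 * 3 * 7 by norm_num, Real.log_mul (by positivity) (by positivity), Real.log_mul (by positivity) (by positivity)]
  have lN_66 : Real.log (66 : ℝ) = Real.log 2 + Real.log 3 + Real.log 11 := by
    rw [show (66 : ℝ) = 2 * 3 * 11 by norm_num, Real.log_mul (by positivity) (by positivity), Real.log_mul (by positivity) (by positivity)]
  have lN_78 : Real.log (78 : ℝ) = Real.log 2 + Real.log 3 + Real.log 13 := by
    rw [show (78 : ℝ) = 2 * 3 * 13 by norm_num, Real.log_mul (by positivity) (by positivity), Real.log_mul (by positivity) (by positivity)]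
  have lN_10127 : Real.log (10127 : ℝ) = Real.log 13 + Real.log 19 + Real.log 41 := by
    rw [show (10127 : ℝ) = 13 * 19 * 41 by norm_num, Real.log_mul (by positivity) (by positivity), Real.log_mul (by positivity) (by positivity)]
  have fN_536481544742 : 0 ≤ Real.log (536481544742 : ℝ) / 536481544742 ∧ Real.log (536481544742 : ℝ) / 536481544742 ≤ 0.0000000000504 := by
    constructor
    · exact div_nonneg (Real.log_nonneg (by norm_num)) (by norm_num)
    · rw [div_le_iff₀ (by norm_num)]
      have hle := Real.log_le_log (by norm_num : (0 : ℝ) < 536481544742) (show (536481544742 : ℝ) ≤ 2 ^ 39 by norm_num)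
      rw [Real.log_pow] at hle; push_cast at hle
      have h2 := Real.log_two_lt_d9
      linarith [hle, h2]
  have hp2a := Real.log_two_gt_d9
  have hp2b := Real.log_two_lt_d9
  have hp3a := Real.log_three_gt_d9
  have hp3b := Real.log_three_lt_d9
  have hp5a := Real.log_five_gt_d9
  have hp5b := Real.log_five_lt_d9
  have hp7a := log_7_bounds.1
  have hp7b := log_7_bounds.2
  have hp11a := log_11_bounds.1
  have hp11b := log_11_bounds.2
  have hp13a := log_13_bounds.1
  have hp13b := log_13_bounds.2
  have hp17a := log_17_bounds.1
  have hp17b := log_17_bounds.2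
  have hp19a := log_19_bounds.1
  have hp19b := log_19_bounds.2
  have hp23a := log_23_bounds.1
  have hp23b := log_23_bounds.2
  have hp29a := log_29_bounds.1
  have hp29b := log_29_bounds.2
  have hp31a := log_31_bounds.1
  have hp31b := log_31_bounds.2
  have hp37a := log_37_bounds.1
  have hp37b := log_37_bounds.2
  have hp41a := log_41_bounds.1
  have hp41b := log_41_bounds.2
  have hp43a := log_43_bounds.1
  have hp43b := log_43_bounds.2
  have hp47a := log_47_bounds.1
  have hp47b := log_47_bounds.2
  have hp53a := log_53_bounds.1
  have hp53b := log_53_bounds.2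
  have hp59a := log_59_bounds.1
  have hp59b := log_59_bounds.2
  have hp61a := log_61_bounds.1
  have hp61b := log_61_bounds.2
  have hp67a := log_67_bounds.1
  have hp67b := log_67_bounds.2
  rw [lN_30, lN_42, lN_66, lN_78, lN_10127]
  constructor <;> linarith [fN_536481544742.1, fN_536481544742.2]

/-- **`1.000780256 ≤ ω ≤ 1.000780261`** (`ω = 1.000780258…`; sixteen prime-logarithm enclosures). [cite: CostaPereira1989, (2.2)–(2.4) (`lim σ(x)/x = ω`; value for this scheme proved here)] -/
theorem ω_bounds : (1.000780256 : ℝ) ≤ ω ∧ ω ≤ 1.000780261 := by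
  have h1 := sumLog_POS_bounds
  have h2 := sumLog_NEG_bounds
  unfold ω
  constructor <;> linarith [h1.1, h1.2, h2.1, h2.2]

/-! ### §6 The block sums `Σ 1/a`, `Σ 1/b`, `Σ 1/t` (integer certificates at scale `10¹²`) -/

/-- Helper `invA` of the `m = 68` certificate (statement = its type; role: see the module docstring). [folklore] -/
private def invA : List (ℕ × ℕ) → ℝ
  | [] => 0
  | b :: l => 1 / (b.1 : ℝ) + invA l

/-- Helper `invB` of the `m = 68` certificate (statement = its type; role: see the module docstring). [folklore] -/
private def invB : List (ℕ × ℕ) → ℝ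
  | [] => 0
  | b :: l => 1 / (b.2 : ℝ) + invB l

/-- Helper `invT` of the `m = 68` certificate (statement = its type; role: see the module docstring). [folklore] -/
private def invT : List ℕ → ℝ
  | [] => 0
  | t :: l => 1 / (t : ℝ) + invT l

/-- Helper `upA` of the `m = 68` certificate (statement = its type; role: see the module docstring). [folklore] -/
private def upA : List (ℕ × ℕ) → ℕ
  | [] => 0
  | b :: l => (1000000000000 + b.1 - 1) / b.1 + upA l

/-- Helper `dnA` of the `m = 68` certificate (statement = its type; role: see the module docstring). [folklore] -/
private def dnA : List (ℕ × ℕ) → ℕ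
  | [] => 0
  | b :: l => 1000000000000 / b.1 + dnA l

/-- Helper `upB` of the `m = 68` certificate (statement = its type; role: see the module docstring). [folklore] -/
private def upB : List (ℕ × ℕ) → ℕ
  | [] => 0
  | b :: l => (1000000000000 + b.2 - 1) / b.2 + upB l

/-- Helper `dnB` of the `m = 68` certificate (statement = its type; role: see the module docstring). [folklore] -/
private def dnB : List (ℕ × ℕ) → ℕ
  | [] => 0
  | b :: l => 1000000000000 / b.2 + dnB l

/-- Helper `upT` of the `m = 68` certificate (statement = its type; role: see the module docstring). [folklore] -/
private def upT : List ℕ → ℕ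
  | [] => 0
  | t :: l => (1000000000000 + t - 1) / t + upT l

/-- Helper `ceilDiv_ge` of the `m = 68` certificate (statement = its type; role: see the module docstring). [folklore] -/
private theorem ceilDiv_ge {K a : ℕ} (ha : 0 < a) : (K : ℝ) / a ≤ (((K + a - 1) / a : ℕ) : ℝ) := by
  have hd := Nat.div_add_mod (K + a - 1) a
  have hm := Nat.mod_lt (K + a - 1) ha
  have ha0 : (0 : ℝ) < a := by exact_mod_cast ha
  rw [div_le_iff₀ ha0]
  have h1 : ((a : ℕ) : ℝ) * (((K + a - 1) / a : ℕ) : ℝ) + (((K + a - 1) % a : ℕ) : ℝ)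
      = ((K + a - 1 : ℕ) : ℝ) := by exact_mod_cast hd
  have h2 : (((K + a - 1) % a : ℕ) : ℝ) + 1 ≤ a := by exact_mod_cast hm
  have h3 : ((K + a - 1 : ℕ) : ℝ) = (K : ℝ) + a - 1 := by
    rw [Nat.cast_sub (by omega), Nat.cast_add]; simp
  rw [h3] at h1
  nlinarith [h1, h2]

/-- Helper `one_div_le_ceil` of the `m = 68` certificate (statement = its type; role: see the module docstring). [folklore] -/
private theorem one_div_le_ceil {a : ℕ} (ha : 0 < a) :
    1 / (a : ℝ) ≤ (((1000000000000 + a - 1) / a : ℕ) : ℝ) / 1000000000000 := by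
  have h := ceilDiv_ge (K := 1000000000000) ha
  push_cast at h
  have e : 1 / (a : ℝ) * 1000000000000 = 1000000000000 / a := by ring
  rw [le_div_iff₀ (by norm_num), e]; exact h

/-- Helper `floor_le_one_div` of the `m = 68` certificate (statement = its type; role: see the module docstring). [folklore] -/
private theorem floor_le_one_div (a : ℕ) :
    ((1000000000000 / a : ℕ) : ℝ) / 1000000000000 ≤ 1 / (a : ℝ) := by
  rcases Nat.eq_zero_or_pos a with h0 | ha
  · subst h0; simp
  · have ha0 : (0 : ℝ) < a := by exact_mod_cast ha
    have h : ((1000000000000 / a : ℕ) : ℝ) ≤ (1000000000000 : ℝ) / a := Nat.cast_div_le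
    rw [le_div_iff₀ ha0] at h
    rw [div_le_div_iff₀ (by norm_num) ha0]; linarith

/-- Helper `invA_le` of the `m = 68` certificate (statement = its type; role: see the module docstring). [folklore] -/
private theorem invA_le (l : List (ℕ × ℕ)) (hl : ∀ b ∈ l, 0 < b.1) : invA l ≤ (upA l : ℝ) / 1000000000000 := by
  induction l with
  | nil => simp [invA, upA]
  | cons b l ih =>
    have hb := hl b (by simp); have ih' := ih (fun b' hb' => hl b' (by simp [hb']))
    simp only [invA, upA, Nat.cast_add, add_div]
    linarith [one_div_le_ceil hb]

/-- Helper `le_invA` of the `m = 68` certificate (statement = its type; role: see the module docstring). [folklore] -/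
private theorem le_invA (l : List (ℕ × ℕ)) : (dnA l : ℝ) / 1000000000000 ≤ invA l := by
  induction l with
  | nil => simp [invA, dnA]
  | cons b l ih =>
    simp only [invA, dnA, Nat.cast_add, add_div]
    linarith [floor_le_one_div b.1]

/-- Helper `invB_le` of the `m = 68` certificate (statement = its type; role: see the module docstring). [folklore] -/
private theorem invB_le (l : List (ℕ × ℕ)) (hl : ∀ b ∈ l, 0 < b.2) : invB l ≤ (upB l : ℝ) / 1000000000000 := by
  induction l with
  | nil => simp [invB, upB]
  | cons b l ih =>
    have hb := hl b (by simp); have ih' := ih (fun b' hb' => hl b' (by simp [hb']))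
    simp only [invB, upB, Nat.cast_add, add_div]
    linarith [one_div_le_ceil hb]

/-- Helper `le_invB` of the `m = 68` certificate (statement = its type; role: see the module docstring). [folklore] -/
private theorem le_invB (l : List (ℕ × ℕ)) : (dnB l : ℝ) / 1000000000000 ≤ invB l := by
  induction l with
  | nil => simp [invB, dnB]
  | cons b l ih =>
    simp only [invB, dnB, Nat.cast_add, add_div]
    linarith [floor_le_one_div b.2]

/-- Helper `invT_le` of the `m = 68` certificate (statement = its type; role: see the module docstring). [folklore] -/
private theorem invT_le (l : List ℕ) (hl : ∀ t ∈ l, 0 < t) : invT l ≤ (upT l : ℝ) / 1000000000000 := by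
  induction l with
  | nil => simp [invT, upT]
  | cons t l ih =>
    have ht := hl t (by simp); have ih' := ih (fun t' ht' => hl t' (by simp [ht']))
    simp only [invT, upT, Nat.cast_add, add_div]
    linarith [one_div_le_ceil ht]

/-- Kernel evaluation of a scaled reciprocal block/tail sum. [folklore] -/
private theorem upA_BLo : upA BLo = 200893777375 := by decide +kernel

/-- Kernel evaluation of a scaled reciprocal block/tail sum. [folklore] -/
private theorem dnB_BLo : dnB BLo = 190550244726 := by decide +kernel

/-- Kernel evaluation of a scaled reciprocal block/tail sum. [folklore] -/
private theorem upB_GLo : upB GLo = 67534353025 := by decide +kernel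

/-- Kernel evaluation of a scaled reciprocal block/tail sum. [folklore] -/
private theorem dnA_GLo : dnA GLo = 72147442370 := by decide +kernel

/-- Kernel evaluation of a scaled reciprocal block/tail sum. [folklore] -/
private theorem upT_TLo : upT TLo = 2184245961 := by decide +kernel

/-- Kernel evaluation of a scaled reciprocal block/tail sum. [folklore] -/
private theorem upA_BUp : upA BUp = 195037153481 := by decide +kernel

/-- Kernel evaluation of a scaled reciprocal block/tail sum. [folklore] -/
private theorem dnB_BUp : dnB BUp = 184197404878 := by decide +kernel

/-- Kernel evaluation of a scaled reciprocal block/tail sum. [folklore] -/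
private theorem upB_GUp : upB GUp = 73902982438 := by decide +kernel

/-- Kernel evaluation of a scaled reciprocal block/tail sum. [folklore] -/
private theorem dnA_GUp : dnA GUp = 78831821905 := by decide +kernel

/-- Kernel evaluation of a scaled reciprocal block/tail sum. [folklore] -/
private theorem upT_TUp : upT TUp = 800000016 := by decide +kernel

/-! ### §7 The affine comparison step (parametric in the a-priori constants) -/

/-- Helper `blkPsi_le'` of the `m = 68` certificate (statement = its type; role: see the module docstring). [folklore] -/
private theorem blkPsi_le' {l₀ u₀ Y x : ℝ} (hx : 0 < x) (hYx : 30000 * Y ≤ x) (l : List (ℕ × ℕ))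
    (hl : ∀ b ∈ l, 1 ≤ b.1 ∧ b.1 ≤ b.2 ∧ b.2 ≤ 30000)
    (IH : ∀ y : ℝ, Y ≤ y → l₀ * y ≤ ψ y ∧ ψ y ≤ u₀ * y) :
    blkPsi x l ≤ x * (u₀ * invA l - l₀ * invB l) := by
  induction l with
  | nil => simp [blkPsi, invA, invB]
  | cons b l ih =>
    obtain ⟨hu, huv, hv⟩ := hl b (by simp)
    have ih' := ih (fun b' hb' => hl b' (by simp [hb']))
    have hu0 : (0 : ℝ) < b.1 := by exact_mod_cast (show 0 < b.1 by omega)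
    have hv0 : (0 : ℝ) < b.2 := by exact_mod_cast (show 0 < b.2 by omega)
    have hv' : (b.2 : ℝ) ≤ 30000 := by exact_mod_cast hv
    have huv' : (b.1 : ℝ) ≤ b.2 := by exact_mod_cast huv
    have hYv : Y ≤ x / b.2 := by rw [le_div_iff₀ hv0]; nlinarith
    have hYu : Y ≤ x / b.1 := le_trans hYv (div_le_div_of_nonneg_left hx.le hu0 huv')
    have hyu := (IH (x / b.1) hYu).2
    have hyv := (IH (x / b.2) hYv).1
    simp only [blkPsi, List.map_cons, List.sum_cons, invA, invB] at ih' ⊢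
    have e1 : u₀ * (x / b.1) = x * (u₀ * (1 / b.1)) := by ring
    have e2 : l₀ * (x / b.2) = x * (l₀ * (1 / b.2)) := by ring
    nlinarith [hyu, hyv, ih', e1, e2]

/-- Helper `le_blkPsi'` of the `m = 68` certificate (statement = its type; role: see the module docstring). [folklore] -/
private theorem le_blkPsi' {l₀ u₀ Y x : ℝ} (hx : 0 < x) (hYx : 30000 * Y ≤ x) (l : List (ℕ × ℕ))
    (hl : ∀ b ∈ l, 1 ≤ b.1 ∧ b.1 ≤ b.2 ∧ b.2 ≤ 30000)
    (IH : ∀ y : ℝ, Y ≤ y → l₀ * y ≤ ψ y ∧ ψ y ≤ u₀ * y) :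
    x * (l₀ * invA l - u₀ * invB l) ≤ blkPsi x l := by
  induction l with
  | nil => simp [blkPsi, invA, invB]
  | cons b l ih =>
    obtain ⟨hu, huv, hv⟩ := hl b (by simp)
    have ih' := ih (fun b' hb' => hl b' (by simp [hb']))
    have hu0 : (0 : ℝ) < b.1 := by exact_mod_cast (show 0 < b.1 by omega)
    have hv0 : (0 : ℝ) < b.2 := by exact_mod_cast (show 0 < b.2 by omega)
    have hv' : (b.2 : ℝ) ≤ 30000 := by exact_mod_cast hv
    have huv' : (b.1 : ℝ) ≤ b.2 := by exact_mod_cast huv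
    have hYv : Y ≤ x / b.2 := by rw [le_div_iff₀ hv0]; nlinarith
    have hYu : Y ≤ x / b.1 := le_trans hYv (div_le_div_of_nonneg_left hx.le hu0 huv')
    have hyu := (IH (x / b.1) hYu).1
    have hyv := (IH (x / b.2) hYv).2
    simp only [blkPsi, List.map_cons, List.sum_cons, invA, invB] at ih' ⊢
    have e1 : l₀ * (x / b.1) = x * (l₀ * (1 / b.1)) := by ring
    have e2 : u₀ * (x / b.2) = x * (u₀ * (1 / b.2)) := by ring
    nlinarith [hyu, hyv, ih', e1, e2]

/-- Helper `tailPsi_le'` of the `m = 68` certificate (statement = its type; role: see the module docstring). [folklore] -/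
private theorem tailPsi_le' {l₀ u₀ Y x : ℝ} (hx : 0 < x) (hYx : 30000 * Y ≤ x) (l : List ℕ)
    (hl : ∀ t ∈ l, 1 ≤ t ∧ t ≤ 30000)
    (IH : ∀ y : ℝ, Y ≤ y → l₀ * y ≤ ψ y ∧ ψ y ≤ u₀ * y) :
    tailPsi x l ≤ x * (u₀ * invT l) := by
  induction l with
  | nil => simp [tailPsi, invT]
  | cons t l ih =>
    obtain ⟨ht, ht'⟩ := hl t (by simp)
    have ih' := ih (fun t'' h'' => hl t'' (by simp [h'']))
    have ht0 : (0 : ℝ) < t := by exact_mod_cast (show 0 < t by omega)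
    have ht2 : (t : ℝ) ≤ 30000 := by exact_mod_cast ht'
    have hYt : Y ≤ x / t := by rw [le_div_iff₀ ht0]; nlinarith
    have hy := (IH (x / t) hYt).2
    simp only [tailPsi, List.map_cons, List.sum_cons, invT] at ih' ⊢
    have e1 : u₀ * (x / t) = x * (u₀ * (1 / t)) := by ring
    nlinarith [hy, ih', e1]

/-- Helper `le_tailPsi'` of the `m = 68` certificate (statement = its type; role: see the module docstring). [folklore] -/
private theorem le_tailPsi' {l₀ u₀ Y x : ℝ} (hx : 0 < x) (hYx : 30000 * Y ≤ x) (l : List ℕ)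
    (hl : ∀ t ∈ l, 1 ≤ t ∧ t ≤ 30000)
    (IH : ∀ y : ℝ, Y ≤ y → l₀ * y ≤ ψ y ∧ ψ y ≤ u₀ * y) :
    x * (l₀ * invT l) ≤ tailPsi x l := by
  induction l with
  | nil => simp [tailPsi, invT]
  | cons t l ih =>
    obtain ⟨ht, ht'⟩ := hl t (by simp)
    have ih' := ih (fun t'' h'' => hl t'' (by simp [h'']))
    have ht0 : (0 : ℝ) < t := by exact_mod_cast (show 0 < t by omega)
    have ht2 : (t : ℝ) ≤ 30000 := by exact_mod_cast ht'
    have hYt : Y ≤ x / t := by rw [le_div_iff₀ ht0]; nlinarith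
    have hy := (IH (x / t) hYt).1
    simp only [tailPsi, List.map_cons, List.sum_cons, invT] at ih' ⊢
    have e1 : l₀ * (x / t) = x * (l₀ * (1 / t)) := by ring
    nlinarith [hy, ih', e1]

/-- **The affine step, lower side**: from `l₀ y ≤ ψ(y) ≤ u₀ y` (`y ≥ Y`) to
`(ω − u₀·S_A + l₀·S_B) x − 50 (log x + 2) ≤ ψ(x)` for `x ≥ 30000·Y`
(`S_A = Σ_{BL} 1/a + Σ_{TL} 1/t + Σ_{GL} 1/v ≤ 0.2706124`, `S_B = Σ_{BL} 1/b + Σ_{GL} 1/u ≥ 0.2626977`).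
[cite: CostaPereira1989, Theorem 2 (2.28)–(2.34), pp. 318–320 (non-inductive affine form proved here)] -/
private theorem step_lower {l₀ u₀ Y x : ℝ} (hl₀ : 0 ≤ l₀) (hu₀ : 0 ≤ u₀) (hY : 1 ≤ Y) (hYx : 30000 * Y ≤ x)
    (IH : ∀ y : ℝ, Y ≤ y → l₀ * y ≤ ψ y ∧ ψ y ≤ u₀ * y) :
    (ω - u₀ * ((270612376361 : ℝ) / 1000000000000) + l₀ * ((262697687096 : ℝ) / 1000000000000)) * x
      - 50 * (Real.log x + 2) ≤ ψ x := by
  have hx1 : 1 ≤ x := by nlinarith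
  have hx0 : 0 < x := by linarith
  have hV := (abs_le.1 (abs_V_sub_le hx1)).1
  have hlo := V_le_psi_comb x
  have b1 := blkPsi_le' hx0 hYx BLo (by decide) IH
  have b2 := le_blkPsi' hx0 hYx GLo (by decide) IH
  have b3 := tailPsi_le' hx0 hYx TLo (by decide) IH
  have c1 := invA_le BLo (by decide); rw [upA_BLo] at c1
  have c2 := le_invB BLo; rw [dnB_BLo] at c2
  have c3 := invB_le GLo (by decide); rw [upB_GLo] at c3
  have c4 := le_invA GLo; rw [dnA_GLo] at c4
  have c5 := invT_le TLo (by decide); rw [upT_TLo] at c5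
  have hxu : 0 ≤ x * u₀ := by positivity
  have hxl : 0 ≤ x * l₀ := by positivity
  have d1 := mul_le_mul_of_nonneg_left c1 hxu
  have d2 := mul_le_mul_of_nonneg_left c2 hxl
  have d3 := mul_le_mul_of_nonneg_left c3 hxu
  have d4 := mul_le_mul_of_nonneg_left c4 hxl
  have d5 := mul_le_mul_of_nonneg_left c5 hxu
  push_cast at d1 d2 d3 d4 d5
  nlinarith [hV, hlo, b1, b2, b3, d1, d2, d3, d4, d5]

/-- **The affine step, upper side**: `ψ(x) ≤ (ω + u₀·T_A − l₀·T_B) x + 50 (log x + 2)` for `x ≥ 30000·Y`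
(`T_A = Σ_{BU} 1/a + Σ_{TU} 1/t + Σ_{GU} 1/v ≤ 0.2697401`, `T_B = Σ_{BU} 1/b + Σ_{GU} 1/u ≥ 0.2630292`).
[cite: CostaPereira1989, Theorem 2 (2.28)–(2.34), pp. 318–320 (non-inductive affine form proved here)] -/
private theorem step_upper {l₀ u₀ Y x : ℝ} (hl₀ : 0 ≤ l₀) (hu₀ : 0 ≤ u₀) (hY : 1 ≤ Y) (hYx : 30000 * Y ≤ x)
    (IH : ∀ y : ℝ, Y ≤ y → l₀ * y ≤ ψ y ∧ ψ y ≤ u₀ * y) :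
    ψ x ≤ (ω + u₀ * ((269740135935 : ℝ) / 1000000000000) - l₀ * ((263029226783 : ℝ) / 1000000000000)) * x
      + 50 * (Real.log x + 2) := by
  have hx1 : 1 ≤ x := by nlinarith
  have hx0 : 0 < x := by linarith
  have hV := (abs_le.1 (abs_V_sub_le hx1)).2
  have hhi := psi_comb_le_V x
  have b1 := blkPsi_le' hx0 hYx BUp (by decide) IH
  have b2 := le_blkPsi' hx0 hYx GUp (by decide) IH
  have b3 := tailPsi_le' hx0 hYx TUp (by decide) IH
  have c1 := invA_le BUp (by decide); rw [upA_BUp] at c1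
  have c2 := le_invB BUp; rw [dnB_BUp] at c2
  have c3 := invB_le GUp (by decide); rw [upB_GUp] at c3
  have c4 := le_invA GUp; rw [dnA_GUp] at c4
  have c5 := invT_le TUp (by decide); rw [upT_TUp] at c5
  have hxu : 0 ≤ x * u₀ := by positivity
  have hxl : 0 ≤ x * l₀ := by positivity
  have d1 := mul_le_mul_of_nonneg_left c1 hxu
  have d2 := mul_le_mul_of_nonneg_left c2 hxl
  have d3 := mul_le_mul_of_nonneg_left c3 hxu
  have d4 := mul_le_mul_of_nonneg_left c4 hxl
  have d5 := mul_le_mul_of_nonneg_left c5 hxu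
  push_cast at d1 d2 d3 d4 d5
  nlinarith [hV, hhi, b1, b2, b3, d1, d2, d3, d4, d5]

/-! ### §8 The shots (non-inductive bootstrap from the `m = 17` constants) -/

/-- Helper `log_le_sub_add_div` of the `m = 68` certificate (statement = its type; role: see the module docstring). [folklore] -/
private theorem log_le_sub_add_div {x K : ℝ} (hx : 0 < x) : Real.log x ≤ K - 1 + x / Real.exp K := by
  have h := Real.log_le_sub_one_of_pos (show 0 < x / Real.exp K by positivity)
  rw [Real.log_div hx.ne' (Real.exp_pos K).ne', Real.log_exp] at h; linarith

/-- A decimal lower bound for `e^26`. [folklore] -/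
private theorem exp_26_ge : (190000000000 : ℝ) ≤ Real.exp 26 := by
  have h1 : Real.exp 26 = Real.exp 1 ^ 26 := by rw [← Real.exp_nat_mul]; norm_num
  have h2 := Real.exp_one_gt_d9
  rw [h1]
  exact le_trans (by norm_num) (pow_le_pow_left₀ (by norm_num) h2.le 26)

/-- A decimal lower bound for `e^36`. [folklore] -/
private theorem exp_36_ge : (4300000000000000 : ℝ) ≤ Real.exp 36 := by
  have h1 : Real.exp 36 = Real.exp 1 ^ 36 := by rw [← Real.exp_nat_mul]; norm_num
  have h2 := Real.exp_one_gt_d9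
  rw [h1]
  exact le_trans (by norm_num) (pow_le_pow_left₀ (by norm_num) h2.le 36)

/-- The error `50 (log x + 2)` relative to `x` on the three scales. [folklore] -/
private theorem err_le_1 {x : ℝ} (hx : 6810000 ≤ x) : 50 * (Real.log x + 2) ≤ 0.0001332 * x := by
  have h := log_le_linear (show 0 < x by linarith); nlinarith

/-- The error `50 (log x + 2)` relative to `x` on this scale. [folklore] -/
private theorem err_le_2 {x : ℝ} (hx : 204300000000 ≤ x) : 50 * (Real.log x + 2) ≤ 0.000000007 * x := by
  have h := log_le_sub_add_div (K := 26) (show 0 < x by linarith)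
  have he := exp_26_ge
  have h' : x / Real.exp 26 ≤ x / 190000000000 := div_le_div_of_nonneg_left (by linarith) (by norm_num) he
  nlinarith

/-- The error `50 (log x + 2)` relative to `x` on this scale. [folklore] -/
private theorem err_le_3 {x : ℝ} (hx : 6129000000000000 ≤ x) : 50 * (Real.log x + 2) ≤ 0.000000000001 * x := by
  have h := log_le_sub_add_div (K := 36) (show 0 < x by linarith)
  have he := exp_36_ge
  have h' : x / Real.exp 36 ≤ x / 4300000000000000 := div_le_div_of_nonneg_left (by linarith) (by norm_num) he
  nlinarith

/-- The a-priori constants of the `m = 17` scheme (ROUND-43, Part C §F). [folklore] -/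
private theorem base0 : ∀ y : ℝ, 227 ≤ y → 0.9636 * y ≤ ψ y ∧ ψ y ≤ 1.0364 * y :=
  fun y hy => ⟨cp17_lower hy, cp17_upper (by linarith)⟩

/-- **Shot 1: `0.973319·x ≤ ψ(x) ≤ 1.027018·x` for `x ≥ 227·30000^1` (`= e^{15.73}`)** — one application of the
affine comparison step to the treeʼs `m = 17` constants `0.9636 / 1.0364`. [cite: CostaPereira1989, Theorem 2 (2.28)–(2.34) (the comparison step; applied here non-inductively, constants proved here)] -/
theorem shot1 : ∀ x : ℝ, 6810000 ≤ x → 0.973319 * x ≤ ψ x ∧ ψ x ≤ 1.027018 * x := by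
  intro x hx
  have hx0 : 0 ≤ x := by linarith
  have h1 := step_lower (l₀ := 0.9636) (u₀ := 1.0364) (Y := 227) (x := x) (by norm_num) (by norm_num) (by norm_num) (by linarith) base0
  have h2 := step_upper (l₀ := 0.9636) (u₀ := 1.0364) (Y := 227) (x := x) (by norm_num) (by norm_num) (by norm_num) (by linarith) base0
  have hω := ω_bounds
  have he := err_le_1 (x := x) (by linarith)
  have w1 := mul_le_mul_of_nonneg_right hω.1 hx0
  have w2 := mul_le_mul_of_nonneg_right hω.2 hx0
  constructor <;> linarith [h1, h2, he, w1, w2]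

/-- **Shot 2: `0.978545·x ≤ ψ(x) ≤ 1.021797·x` for `x ≥ 227·30000^2` (`= e^{26.04}`)** — one application of the
affine comparison step to `shot1`. [cite: CostaPereira1989, Theorem 2 (2.28)–(2.34) (the comparison step; applied here non-inductively, constants proved here)] -/
theorem shot2 : ∀ x : ℝ, 204300000000 ≤ x → 0.978545 * x ≤ ψ x ∧ ψ x ≤ 1.021797 * x := by
  intro x hx
  have hx0 : 0 ≤ x := by linarith
  have h1 := step_lower (l₀ := 0.973319) (u₀ := 1.027018) (Y := 6810000) (x := x) (by norm_num) (by norm_num) (by norm_num) (by linarith) shot1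
  have h2 := step_upper (l₀ := 0.973319) (u₀ := 1.027018) (Y := 6810000) (x := x) (by norm_num) (by norm_num) (by norm_num) (by linarith) shot1
  have hω := ω_bounds
  have he := err_le_2 (x := x) (by linarith)
  have w1 := mul_le_mul_of_nonneg_right hω.1 hx0
  have w2 := mul_le_mul_of_nonneg_right hω.2 hx0
  constructor <;> linarith [h1, h2, he, w1, w2]

/-- **Shot 3: `0.98133·x ≤ ψ(x) ≤ 1.019014·x` for `x ≥ 227·30000^3` (`= e^{36.35}`)** — one application of the
affine comparison step to `shot2`. [cite: CostaPereira1989, Theorem 2 (2.28)–(2.34) (the comparison step; applied here non-inductively, constants proved here)] -/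
theorem shot3 : ∀ x : ℝ, 6129000000000000 ≤ x → 0.98133 * x ≤ ψ x ∧ ψ x ≤ 1.019014 * x := by
  intro x hx
  have hx0 : 0 ≤ x := by linarith
  have h1 := step_lower (l₀ := 0.978545) (u₀ := 1.021797) (Y := 204300000000) (x := x) (by norm_num) (by norm_num) (by norm_num) (by linarith) shot2
  have h2 := step_upper (l₀ := 0.978545) (u₀ := 1.021797) (Y := 204300000000) (x := x) (by norm_num) (by norm_num) (by norm_num) (by linarith) shot2
  have hω := ω_bounds
  have he := err_le_3 (x := x) (by linarith)
  have w1 := mul_le_mul_of_nonneg_right hω.1 hx0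
  have w2 := mul_le_mul_of_nonneg_right hω.2 hx0
  constructor <;> linarith [h1, h2, he, w1, w2]

/-- **Shot 4: `0.982815·x ≤ ψ(x) ≤ 1.017531·x` for `x ≥ 227·30000^4` (`= e^{46.66}`)** — one application of the
affine comparison step to `shot3`. [cite: CostaPereira1989, Theorem 2 (2.28)–(2.34) (the comparison step; applied here non-inductively, constants proved here)] -/
theorem shot4 : ∀ x : ℝ, 183870000000000000000 ≤ x → 0.982815 * x ≤ ψ x ∧ ψ x ≤ 1.017531 * x := by
  intro x hx
  have hx0 : 0 ≤ x := by linarith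
  have h1 := step_lower (l₀ := 0.98133) (u₀ := 1.019014) (Y := 6129000000000000) (x := x) (by norm_num) (by norm_num) (by norm_num) (by linarith) shot3
  have h2 := step_upper (l₀ := 0.98133) (u₀ := 1.019014) (Y := 6129000000000000) (x := x) (by norm_num) (by norm_num) (by norm_num) (by linarith) shot3
  have hω := ω_bounds
  have he := err_le_3 (x := x) (by linarith)
  have w1 := mul_le_mul_of_nonneg_right hω.1 hx0
  have w2 := mul_le_mul_of_nonneg_right hω.2 hx0
  constructor <;> linarith [h1, h2, he, w1, w2]

/-- **Shot 5: `0.983607·x ≤ ψ(x) ≤ 1.016741·x` for `x ≥ 227·30000^5` (`= e^{56.97}`)** — one application of the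
affine comparison step to `shot4`. [cite: CostaPereira1989, Theorem 2 (2.28)–(2.34) (the comparison step; applied here non-inductively, constants proved here)] -/
theorem shot5 : ∀ x : ℝ, 5516100000000000000000000 ≤ x → 0.983607 * x ≤ ψ x ∧ ψ x ≤ 1.016741 * x := by
  intro x hx
  have hx0 : 0 ≤ x := by linarith
  have h1 := step_lower (l₀ := 0.982815) (u₀ := 1.017531) (Y := 183870000000000000000) (x := x) (by norm_num) (by norm_num) (by norm_num) (by linarith) shot4
  have h2 := step_upper (l₀ := 0.982815) (u₀ := 1.017531) (Y := 183870000000000000000) (x := x) (by norm_num) (by norm_num) (by norm_num) (by linarith) shot4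
  have hω := ω_bounds
  have he := err_le_3 (x := x) (by linarith)
  have w1 := mul_le_mul_of_nonneg_right hω.1 hx0
  have w2 := mul_le_mul_of_nonneg_right hω.2 hx0
  constructor <;> linarith [h1, h2, he, w1, w2]

/-- **Shot 6: `0.984028·x ≤ ψ(x) ≤ 1.016319·x` for `x ≥ 227·30000^6` (`= e^{67.28}`)** — one application of the
affine comparison step to `shot5`. [cite: CostaPereira1989, Theorem 2 (2.28)–(2.34) (the comparison step; applied here non-inductively, constants proved here)] -/
theorem shot6 : ∀ x : ℝ, 165483000000000000000000000000 ≤ x → 0.984028 * x ≤ ψ x ∧ ψ x ≤ 1.016319 * x := by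
  intro x hx
  have hx0 : 0 ≤ x := by linarith
  have h1 := step_lower (l₀ := 0.983607) (u₀ := 1.016741) (Y := 5516100000000000000000000) (x := x) (by norm_num) (by norm_num) (by norm_num) (by linarith) shot5
  have h2 := step_upper (l₀ := 0.983607) (u₀ := 1.016741) (Y := 5516100000000000000000000) (x := x) (by norm_num) (by norm_num) (by norm_num) (by linarith) shot5
  have hω := ω_bounds
  have he := err_le_3 (x := x) (by linarith)
  have w1 := mul_le_mul_of_nonneg_right hω.1 hx0
  have w2 := mul_le_mul_of_nonneg_right hω.2 hx0
  constructor <;> linarith [h1, h2, he, w1, w2]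

/-- **Shot 7: `0.984253·x ≤ ψ(x) ≤ 1.016095·x` for `x ≥ 227·30000^7` (`= e^{77.59}`)** — one application of the
affine comparison step to `shot6`. [cite: CostaPereira1989, Theorem 2 (2.28)–(2.34) (the comparison step; applied here non-inductively, constants proved here)] -/
theorem shot7 : ∀ x : ℝ, 4964490000000000000000000000000000 ≤ x → 0.984253 * x ≤ ψ x ∧ ψ x ≤ 1.016095 * x := by
  intro x hx
  have hx0 : 0 ≤ x := by linarith
  have h1 := step_lower (l₀ := 0.984028) (u₀ := 1.016319) (Y := 165483000000000000000000000000) (x := x) (by norm_num) (by norm_num) (by norm_num) (by linarith) shot6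
  have h2 := step_upper (l₀ := 0.984028) (u₀ := 1.016319) (Y := 165483000000000000000000000000) (x := x) (by norm_num) (by norm_num) (by norm_num) (by linarith) shot6
  have hω := ω_bounds
  have he := err_le_3 (x := x) (by linarith)
  have w1 := mul_le_mul_of_nonneg_right hω.1 hx0
  have w2 := mul_le_mul_of_nonneg_right hω.2 hx0
  constructor <;> linarith [h1, h2, he, w1, w2]

/-- **Shot 8: `0.984373·x ≤ ψ(x) ≤ 1.015975·x` for `x ≥ 227·30000^8` (`= e^{87.90}`)** — one application of the
affine comparison step to `shot7`. [cite: CostaPereira1989, Theorem 2 (2.28)–(2.34) (the comparison step; applied here non-inductively, constants proved here)] -/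
theorem shot8 : ∀ x : ℝ, 148934700000000000000000000000000000000 ≤ x → 0.984373 * x ≤ ψ x ∧ ψ x ≤ 1.015975 * x := by
  intro x hx
  have hx0 : 0 ≤ x := by linarith
  have h1 := step_lower (l₀ := 0.984253) (u₀ := 1.016095) (Y := 4964490000000000000000000000000000) (x := x) (by norm_num) (by norm_num) (by norm_num) (by linarith) shot7
  have h2 := step_upper (l₀ := 0.984253) (u₀ := 1.016095) (Y := 4964490000000000000000000000000000) (x := x) (by norm_num) (by norm_num) (by norm_num) (by linarith) shot7
  have hω := ω_bounds
  have he := err_le_3 (x := x) (by linarith)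
  have w1 := mul_le_mul_of_nonneg_right hω.1 hx0
  have w2 := mul_le_mul_of_nonneg_right hω.2 hx0
  constructor <;> linarith [h1, h2, he, w1, w2]

/-- **Shot 9: `0.984437·x ≤ ψ(x) ≤ 1.015911·x` for `x ≥ 227·30000^9` (`= e^{98.21}`)** — one application of the
affine comparison step to `shot8`. [cite: CostaPereira1989, Theorem 2 (2.28)–(2.34) (the comparison step; applied here non-inductively, constants proved here)] -/
theorem shot9 : ∀ x : ℝ, 4468041000000000000000000000000000000000000 ≤ x → 0.984437 * x ≤ ψ x ∧ ψ x ≤ 1.015911 * x := by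
  intro x hx
  have hx0 : 0 ≤ x := by linarith
  have h1 := step_lower (l₀ := 0.984373) (u₀ := 1.015975) (Y := 148934700000000000000000000000000000000) (x := x) (by norm_num) (by norm_num) (by norm_num) (by linarith) shot8
  have h2 := step_upper (l₀ := 0.984373) (u₀ := 1.015975) (Y := 148934700000000000000000000000000000000) (x := x) (by norm_num) (by norm_num) (by norm_num) (by linarith) shot8
  have hω := ω_bounds
  have he := err_le_3 (x := x) (by linarith)
  have w1 := mul_le_mul_of_nonneg_right hω.1 hx0
  have w2 := mul_le_mul_of_nonneg_right hω.2 hx0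
  constructor <;> linarith [h1, h2, he, w1, w2]

/-- **Shot 10: `0.984471·x ≤ ψ(x) ≤ 1.015877·x` for `x ≥ 227·30000^10` (`= e^{108.51}`)** — one application of the
affine comparison step to `shot9`. [cite: CostaPereira1989, Theorem 2 (2.28)–(2.34) (the comparison step; applied here non-inductively, constants proved here)] -/
theorem shot10 : ∀ x : ℝ, 134041230000000000000000000000000000000000000000 ≤ x → 0.984471 * x ≤ ψ x ∧ ψ x ≤ 1.015877 * x := by
  intro x hx
  have hx0 : 0 ≤ x := by linarith
  have h1 := step_lower (l₀ := 0.984437) (u₀ := 1.015911) (Y := 4468041000000000000000000000000000000000000) (x := x) (by norm_num) (by norm_num) (by norm_num) (by linarith) shot9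
  have h2 := step_upper (l₀ := 0.984437) (u₀ := 1.015911) (Y := 4468041000000000000000000000000000000000000) (x := x) (by norm_num) (by norm_num) (by norm_num) (by linarith) shot9
  have hω := ω_bounds
  have he := err_le_3 (x := x) (by linarith)
  have w1 := mul_le_mul_of_nonneg_right hω.1 hx0
  have w2 := mul_le_mul_of_nonneg_right hω.2 hx0
  constructor <;> linarith [h1, h2, he, w1, w2]

/-- `π(n) ≥ ψ(n)/log n`-conversion of the shots (Mathlib `Chebyshev.psi_le_primeCounting_mul_log`). [folklore] -/
private theorem primeCounting_ge_of_psi {c X : ℝ} (h : ∀ x : ℝ, X ≤ x → c * x ≤ ψ x) {n : ℕ} (hX : X ≤ n) (hn : 2 ≤ n) :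
    c * n / Real.log n ≤ (Nat.primeCounting n : ℝ) := by
  have h1 := (h n hX)
  have h2 := Chebyshev.psi_le_primeCounting_mul_log n
  have hlog : 0 < Real.log n := Real.log_pos (by exact_mod_cast (by omega : 1 < n))
  rw [div_le_iff₀ hlog]; linarith

/-- **`π(n) ≥ 0.98133·n/log n` for `n ≥ 227·30000³ = 6.129·10¹⁵`**, from `shot3` and `ψ(n) ≤ π(n) log n`.
[cite: CostaPereira1989, Theorem 2 (2.34) (method); constant and range proved here] -/
theorem primeCounting_ge_3 {n : ℕ} (hn : 6129000000000000 ≤ n) :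
    0.98133 * (n : ℝ) / Real.log n ≤ (Nat.primeCounting n : ℝ) :=
  primeCounting_ge_of_psi (fun x hx => (shot3 x hx).1) (by exact_mod_cast hn) (by omega)

/-- **`π(n) ≥ 0.982815·n/log n` for `n ≥ 227·30000⁴ = 1.8387·10²⁰`**, from `shot4`.
[cite: CostaPereira1989, Theorem 2 (2.34) (method); constant and range proved here] -/
theorem primeCounting_ge_4 {n : ℕ} (hn : 183870000000000000000 ≤ n) :
    0.982815 * (n : ℝ) / Real.log n ≤ (Nat.primeCounting n : ℝ) :=
  primeCounting_ge_of_psi (fun x hx => (shot4 x hx).1) (by exact_mod_cast hn) (by omega)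

/-- **`π(n) ≥ 0.984437·n/log n` for `n ≥ 227·30000⁹ = 4.468·10⁴²`**, from `shot9`.
[cite: CostaPereira1989, Theorem 2 (2.34) (method); constant and range proved here] -/
theorem primeCounting_ge_9 {n : ℕ} (hn : 4468041000000000000000000000000000000000000 ≤ n) :
    0.984437 * (n : ℝ) / Real.log n ≤ (Nat.primeCounting n : ℝ) :=
  primeCounting_ge_of_psi (fun x hx => (shot9 x hx).1) (by exact_mod_cast hn) (by omega)

end

end Literature.NumberTheory.LFunctions.CostaPereira68
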